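import Literature.NumberTheory.Sieve.BombieriFriedlanderIwaniecDispersionS1
import HarnessLib

/-!
# Bombieri–Friedlander–Iwaniec 1986, §6 (6.3)–(6.4) for Theorem 1: `𝒮₁` off the main range

Topic `Literature/NumberTheory/Sieve`.  Seventh file of the formalisation of the provable part of
the proof of Theorem 1 of E. Bombieri, J. B. Friedlander, H. Iwaniec, *Primes in arithmetic
progressions to large moduli*, Acta Math. 156 (1986), 203–251.  The file `…DispersionS1` split
`𝒮₁ = 𝒮₁ᶜ + 𝒮₁ⁿ` (`BFI.dS1_eq_dS1c_add_dS1n`), the main range `𝒮₁ᶜ` being `(n₁,n₂) = 1`,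
`q₀ = (q₁,q₂) ≤ Q₀`; here the complementary part `𝒮₁ⁿ = BFI.dS1n` is bounded BEFORE Poisson
summation, following BFI (6.3) ("`𝒮₁(q₀ > Q₀) ≪ ‖β‖² x^{1+ε} Q₀⁻¹ R⁻¹`") and (6.4) ("the
contribution of pairs with `(n₁,n₂) > 1` is `≪ ‖β‖² x ℒ R⁻¹ (N₀⁻¹ℒ^B + QRx^{ε/3−1})`"), by Cauchy's
inequality (`|β_{n₁}β_{n₂}| ≤ (β²_{n₁}+β²_{n₂})/2` and symmetry), BFI's Lemma 3 (Shiu's theorem, in the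
tree as the PROVED `BombieriFriedlanderIwaniecLemma3_holds`; entering here as hypotheses `hL3`,
`hL3'` of its exact shape so that the file stays elementary), trivial counts in short progressions,
and (A₄).  Everything here is PROVED; no named facts are introduced.

## Contents

* Reduction: `BFI.mA1_swap`, `BFI.main_swap`, `BFI.mB` (majorant of `A₁` keeping `(q₁r,a)=1` and
  the two congruences), `BFI.restSum`, **`BFI.abs_dS1n_le_restSum`**
  (`|𝒮₁ⁿ| ≤ restSum[(n₁,n₂)>1] + restSum[(q₁,q₂)>Q₀]`).
* Transfer to Lemma 3: `BFI.l3Set`, `BFI.l3Term` (the summation set and summand of Lemma 3),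
  `BFI.sum_class_rpow_sigma_le_l3` (`n`-sums in a class, via `v = mn`),
  `BFI.sum_mRange_bump_rpow_sigma_le_l3` (`m`-sums), `BFI.sum_mRange_bump_class_le`,
  `BFI.sum_dyadic_dvd_rpow_sigma_le` (`∑_{q∼Q, q∣v} τ(q)^B ≤ τ(v)^{B+1}`), `BFI.card_dyadic_class_le`.
* Rearrangement: `BFI.innerP`, `BFI.restSum_eq`, `BFI.restSum_le_of_innerP_le`.
* (6.4): `BFI.ite_not_coprime_le_sum_primeFactors`, `BFI.sum_dyadic_cong_abs_le`,
  **`BFI.innerP_ncop_le`**, `BFI.innerP_ncop_le'`.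
* (6.3): `BFI.exists_class_of_dvd`, `BFI.sum_dyadic_cong_gcd_abs_le`, **`BFI.innerP_gcd_le`**,
  `BFI.innerP_gcd_le'`.
* `BFI.sum_m_congr_bump_le` (the `m`-sum in the class `mn₁ ≡ a (q₁r)`), `BFI.mRange_bump_facts`, and
  **`BFI.abs_dS1n_le`**: `|𝒮₁ⁿ| ≤ ∑_{r∼R}∑_{q₁∼Q} |γ_{q₁}| ‖β‖² {ω₀(C₃(2N/r)(2τ(r)lg)^{B₃}/z · L₄ +
  T(2N/(P₀R)+1)((2M+Y)/(q₁r)+1)) + τ(q₁)(C₃(2N/(Q₀r))(τ(q₁)τ(r)lg)^{B₃} L₄ + T(2N/(P₀R)+1)((2M+Y)/(q₁r)+1))}`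
  with `L₄ = C₄((2M+Y)/(q₁r))(τ(q₁r) log(2M+Y))^{B₄}`.

## Faithfulness

BFI state (6.3)–(6.4) as `≪`-bounds after divisor-sum averaging; here the two Lemma-3 inputs, the
level conditions (`hlev`, `hlev'`), the divisor bound `T` on the short progressions and the bounds
`lg`, `ω₀` are explicit hypotheses/parameters, and the averaging over `r ∼ R`, `q₁ ∼ Q` is left to
the assembly (`DivisorPowerSums`).  BFI's `μ²(n₁n₂)` plays no role.

## References

* E. Bombieri, J. B. Friedlander, H. Iwaniec, Acta Math. 156 (1986), 203–251, §6 (6.3)–(6.4)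
  p. 220; §2 Lemma 3 p. 211. [BombieriFriedlanderIwaniecActa1986]
-/

noncomputable section

open Finset Real
open scoped ArithmeticFunction.sigma

namespace Literature.NumberTheory.Sieve

namespace BFI

/-! ### `𝒮₁` off the main range: reduction to two nonnegative sums -/

/-- `A₁` is symmetric under `(q₁, n₁) ↔ (q₂, n₂)`. [folklore] -/
theorem mA1_swap (a : ℤ) (S : Finset ℕ) (w : ℕ → ℝ) (r q₁ q₂ n₁ n₂ : ℕ) :
    mA1 a S w r q₁ q₂ n₁ n₂ = mA1 a S w r q₂ q₁ n₂ n₁ := by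
  unfold mA1
  refine Finset.sum_congr rfl fun m _ => if_congr ?_ rfl rfl
  rw [cop_comm]
  tauto

/-- `Main` is symmetric under `(q₁, n₁) ↔ (q₂, n₂)`. [folklore] -/
theorem main_swap (Q₀ : ℝ) (q₁ q₂ n₁ n₂ : ℕ) : Main Q₀ q₁ q₂ n₁ n₂ ↔ Main Q₀ q₂ q₁ n₂ n₁ := by
  simp only [Main, Nat.gcd_comm q₁ q₂, Nat.coprime_comm]

/-- A majorant of `A₁` keeping only `(q₁r, a) = 1` and the two congruences (the weight `w ≥ 0`):
`B(r,q₁,q₂,n₁,n₂) = ∑_{m ∈ S, (q₁r,a)=1, mn₁≡a (q₁r), mn₂≡a (q₂r)} w(m)`. [folklore] -/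
def mB (a : ℤ) (S : Finset ℕ) (w : ℕ → ℝ) (r q₁ q₂ n₁ n₂ : ℕ) : ℝ :=
  ∑ m ∈ S, if IsCoprime ((q₁ * r : ℕ) : ℤ) a ∧ ((m * n₁ : ℕ) : ZMod (q₁ * r)) = (a : ZMod (q₁ * r)) ∧
      ((m * n₂ : ℕ) : ZMod (q₂ * r)) = (a : ZMod (q₂ * r)) then w m else 0

/-- `0 ≤ A₁ ≤ B` for `w ≥ 0`. [folklore] -/
theorem mA1_le_mB {a : ℤ} {S : Finset ℕ} {w : ℕ → ℝ} (hw : ∀ m ∈ S, 0 ≤ w m) (r q₁ q₂ n₁ n₂ : ℕ) :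
    0 ≤ mA1 a S w r q₁ q₂ n₁ n₂ ∧ mA1 a S w r q₁ q₂ n₁ n₂ ≤ mB a S w r q₁ q₂ n₁ n₂ := by
  refine ⟨(mA1_nonneg_le hw r q₁ q₂ n₁ n₂).1, ?_⟩
  unfold mA1 mB
  refine Finset.sum_le_sum fun m hm => ?_
  by_cases h : Cop a r q₁ q₂ m ∧ ((m * n₁ : ℕ) : ZMod (q₁ * r)) = (a : ZMod (q₁ * r)) ∧
      ((m * n₂ : ℕ) : ZMod (q₂ * r)) = (a : ZMod (q₂ * r))
  · rw [if_pos h, if_pos ⟨isCoprime_mul_of_cop h.1, h.2.1, h.2.2⟩]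
  · rw [if_neg h]
    split_ifs
    · exact hw m hm
    · exact le_rfl

/-- `mB ≥ 0` for `w ≥ 0`. [folklore] -/
theorem mB_nonneg {a : ℤ} {S : Finset ℕ} {w : ℕ → ℝ} (hw : ∀ m ∈ S, 0 ≤ w m) (r q₁ q₂ n₁ n₂ : ℕ) :
    0 ≤ mB a S w r q₁ q₂ n₁ n₂ := by
  unfold mB
  exact Finset.sum_nonneg fun m hm => by split_ifs; exacts [hw m hm, le_rfl]

/-- The off-range sum with the diagonal weight `|γ_{q₁}γ_{q₂}| β_{n₁}²` and the predicate `P`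
selecting the terms: `∑_{r,q₁,q₂,n₁,n₂} [P] |γ_{q₁}γ_{q₂}| β_{n₁}² B`. [folklore] -/
def restSum (a : ℤ) (S : Finset ℕ) (N Q R : ℝ) (w β γ : ℕ → ℝ)
    (P : ℕ → ℕ → ℕ → ℕ → Prop) [∀ q₁ q₂ n₁ n₂, Decidable (P q₁ q₂ n₁ n₂)] : ℝ :=
  ∑ r ∈ dyadic R, ∑ q₁ ∈ dyadic Q, ∑ q₂ ∈ dyadic Q, ∑ n₁ ∈ dyadic N, ∑ n₂ ∈ dyadic N,
    if P q₁ q₂ n₁ n₂ then |γ q₁| * |γ q₂| * β n₁ ^ 2 * mB a S w r q₁ q₂ n₁ n₂ else 0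

/-- **`𝒮₁` off the main range is bounded by two nonnegative diagonal sums** (BFI (6.3)–(6.4):
"By Cauchy's inequality we deduce … `𝒮₁(q₀ > Q₀) ≪ ∑ … |β_{n₁}|² …`"): for `w ≥ 0`,
`|𝒮₁ⁿ| ≤ restSum[(n₁,n₂) > 1] + restSum[(q₁,q₂) > Q₀]`
(`|β_{n₁}β_{n₂}| ≤ (β_{n₁}² + β_{n₂}²)/2` and the symmetry `(q₁,n₁) ↔ (q₂,n₂)`).
[cite: BombieriFriedlanderIwaniecActa1986, §6 (6.3)–(6.4) p. 220] -/
theorem abs_dS1n_le_restSum (a : ℤ) {S : Finset ℕ} (N Q R Q₀ : ℝ) {w : ℕ → ℝ}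
    (hw : ∀ m ∈ S, 0 ≤ w m) (β γ : ℕ → ℝ) :
    |dS1n a S N Q R Q₀ w β γ| ≤
      restSum a S N Q R w β γ (fun _ _ n₁ n₂ => ¬n₁.Coprime n₂) +
        restSum a S N Q R w β γ (fun q₁ q₂ _ _ => ¬((Nat.gcd q₁ q₂ : ℝ) ≤ Q₀)) := by
  classical
  have hB0 : ∀ r q₁ q₂ n₁ n₂, 0 ≤ mB a S w r q₁ q₂ n₁ n₂ := fun r q₁ q₂ n₁ n₂ => mB_nonneg hw _ _ _ _ _
  -- Step 1: |summand| ≤ (T + T^swap)/2 with the diagonal weights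
  have hpt : ∀ r q₁ q₂ n₁ n₂, |(if Main Q₀ q₁ q₂ n₁ n₂ then 0 else
      γ q₁ * γ q₂ * β n₁ * β n₂ * mA1 a S w r q₁ q₂ n₁ n₂)| ≤
      (if Main Q₀ q₁ q₂ n₁ n₂ then 0 else |γ q₁| * |γ q₂| * β n₁ ^ 2 * mB a S w r q₁ q₂ n₁ n₂) * 2⁻¹ +
      (if Main Q₀ q₂ q₁ n₂ n₁ then 0 else |γ q₂| * |γ q₁| * β n₂ ^ 2 * mB a S w r q₂ q₁ n₂ n₁) * 2⁻¹ := by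
    intro r q₁ q₂ n₁ n₂
    by_cases h : Main Q₀ q₁ q₂ n₁ n₂
    · rw [if_pos h, if_pos h, if_pos ((main_swap Q₀ q₁ q₂ n₁ n₂).1 h), abs_zero]; norm_num
    · rw [if_neg h, if_neg h, if_neg (fun h' => h ((main_swap Q₀ q₁ q₂ n₁ n₂).2 h'))]
      obtain ⟨hA0, hAB⟩ := mA1_le_mB hw r q₁ q₂ n₁ n₂ (a := a)
      have hB21 : mA1 a S w r q₁ q₂ n₁ n₂ ≤ mB a S w r q₂ q₁ n₂ n₁ := by
        rw [mA1_swap]; exact (mA1_le_mB hw r q₂ q₁ n₂ n₁ (a := a)).2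
      rw [abs_mul, abs_mul, abs_mul, abs_mul, abs_of_nonneg hA0]
      have key : |β n₁| * |β n₂| ≤ (β n₁ ^ 2 + β n₂ ^ 2) / 2 := by
        nlinarith [sq_nonneg (|β n₁| - |β n₂|), sq_abs (β n₁), sq_abs (β n₂)]
      have hg : 0 ≤ |γ q₁| * |γ q₂| := by positivity
      calc |γ q₁| * |γ q₂| * |β n₁| * |β n₂| * mA1 a S w r q₁ q₂ n₁ n₂
          = (|γ q₁| * |γ q₂|) * (|β n₁| * |β n₂|) * mA1 a S w r q₁ q₂ n₁ n₂ := by ring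
        _ ≤ (|γ q₁| * |γ q₂|) * ((β n₁ ^ 2 + β n₂ ^ 2) / 2) * mA1 a S w r q₁ q₂ n₁ n₂ := by
            gcongr
        _ = (|γ q₁| * |γ q₂| * β n₁ ^ 2 * mA1 a S w r q₁ q₂ n₁ n₂) * 2⁻¹ +
              (|γ q₂| * |γ q₁| * β n₂ ^ 2 * mA1 a S w r q₁ q₂ n₁ n₂) * 2⁻¹ := by ring
        _ ≤ (|γ q₁| * |γ q₂| * β n₁ ^ 2 * mB a S w r q₁ q₂ n₁ n₂) * 2⁻¹ +
              (|γ q₂| * |γ q₁| * β n₂ ^ 2 * mB a S w r q₂ q₁ n₂ n₁) * 2⁻¹ := by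
            gcongr
  -- Step 2: sum; the swapped sum equals the unswapped one
  set T : ℕ → ℕ → ℕ → ℕ → ℕ → ℝ := fun r q₁ q₂ n₁ n₂ =>
    if Main Q₀ q₁ q₂ n₁ n₂ then 0 else |γ q₁| * |γ q₂| * β n₁ ^ 2 * mB a S w r q₁ q₂ n₁ n₂ with hT
  have hsum_swap : ∑ r ∈ dyadic R, ∑ q₁ ∈ dyadic Q, ∑ q₂ ∈ dyadic Q, ∑ n₁ ∈ dyadic N,
      ∑ n₂ ∈ dyadic N, T r q₂ q₁ n₂ n₁ * 2⁻¹ =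
      ∑ r ∈ dyadic R, ∑ q₁ ∈ dyadic Q, ∑ q₂ ∈ dyadic Q, ∑ n₁ ∈ dyadic N,
        ∑ n₂ ∈ dyadic N, T r q₁ q₂ n₁ n₂ * 2⁻¹ := by
    refine Finset.sum_congr rfl fun r _ => ?_
    rw [Finset.sum_comm]
    refine Finset.sum_congr rfl fun q₁ _ => Finset.sum_congr rfl fun q₂ _ => ?_
    rw [Finset.sum_comm]
  have hmain : |dS1n a S N Q R Q₀ w β γ| ≤ ∑ r ∈ dyadic R, ∑ q₁ ∈ dyadic Q, ∑ q₂ ∈ dyadic Q,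
      ∑ n₁ ∈ dyadic N, ∑ n₂ ∈ dyadic N, T r q₁ q₂ n₁ n₂ := by
    unfold dS1n
    refine (Finset.abs_sum_le_sum_abs _ _).trans ?_
    refine (Finset.sum_le_sum fun r _ => Finset.abs_sum_le_sum_abs _ _).trans ?_
    refine (Finset.sum_le_sum fun r _ => Finset.sum_le_sum fun q₁ _ =>
      Finset.abs_sum_le_sum_abs _ _).trans ?_
    refine (Finset.sum_le_sum fun r _ => Finset.sum_le_sum fun q₁ _ => Finset.sum_le_sum fun q₂ _ =>
      Finset.abs_sum_le_sum_abs _ _).trans ?_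
    refine (Finset.sum_le_sum fun r _ => Finset.sum_le_sum fun q₁ _ => Finset.sum_le_sum fun q₂ _ =>
      Finset.sum_le_sum fun n₁ _ => Finset.abs_sum_le_sum_abs _ _).trans ?_
    refine (Finset.sum_le_sum fun r _ => Finset.sum_le_sum fun q₁ _ => Finset.sum_le_sum fun q₂ _ =>
      Finset.sum_le_sum fun n₁ _ => Finset.sum_le_sum fun n₂ _ => hpt r q₁ q₂ n₁ n₂).trans ?_
    simp only [Finset.sum_add_distrib]
    rw [hsum_swap, ← two_mul]
    simp only [← Finset.sum_mul]
    have h0 : 0 ≤ ∑ r ∈ dyadic R, ∑ q₁ ∈ dyadic Q, ∑ q₂ ∈ dyadic Q, ∑ n₁ ∈ dyadic N,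
        ∑ n₂ ∈ dyadic N, T r q₁ q₂ n₁ n₂ :=
      Finset.sum_nonneg fun r _ => Finset.sum_nonneg fun q₁ _ => Finset.sum_nonneg fun q₂ _ =>
        Finset.sum_nonneg fun n₁ _ => Finset.sum_nonneg fun n₂ _ => by
          simp only [hT]
          split_ifs
          · exact le_rfl
          · have := hB0 r q₁ q₂ n₁ n₂; positivity
    linarith
  -- Step 3: `T ≤ [¬cop]… + [gcd > Q₀]…`
  refine hmain.trans ?_
  unfold restSum
  simp only [← Finset.sum_add_distrib]
  refine Finset.sum_le_sum fun r _ => Finset.sum_le_sum fun q₁ _ => Finset.sum_le_sum fun q₂ _ =>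
    Finset.sum_le_sum fun n₁ _ => Finset.sum_le_sum fun n₂ _ => ?_
  simp only [hT, Main]
  have hX : 0 ≤ |γ q₁| * |γ q₂| * β n₁ ^ 2 * mB a S w r q₁ q₂ n₁ n₂ := by
    have := hB0 r q₁ q₂ n₁ n₂; positivity
  by_cases hc : n₁.Coprime n₂ <;> by_cases hg : (Nat.gcd q₁ q₂ : ℝ) ≤ Q₀
  · rw [if_pos ⟨hc, hg⟩, if_neg (not_not_intro hc), if_neg (not_not_intro hg)]; linarith
  · rw [if_neg (fun h => hg h.2), if_neg (not_not_intro hc), if_pos hg]; linarith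
  · rw [if_neg (fun h => hc h.1), if_pos hc, if_neg (not_not_intro hg)]; linarith
  · rw [if_neg (fun h => hc h.1), if_pos hc, if_pos hg]; linarith


/-! ### Transfer lemmas to the shape of Lemma 3 -/

/-- The summation set of BFI's Lemma 3: `{1 ≤ v ≤ X : |a| < v, v ≡ l (mod k)}`.
[cite: BombieriFriedlanderIwaniecActa1986, §2 Lemma 3 p. 211] -/
def l3Set (a : ℤ) (X : ℝ) (k : ℕ) (l : ZMod k) : Finset ℕ :=
  (Finset.Icc 1 ⌊X⌋₊).filter (fun v : ℕ => |a| < (v : ℤ) ∧ (v : ZMod k) = l)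

/-- The summand of Lemma 3: `τ(v)^A τ(v − a)^A`. [cite: BombieriFriedlanderIwaniecActa1986, §2 Lemma 3 p. 211] -/
def l3Term (a : ℤ) (A : ℝ) (v : ℕ) : ℝ := (σ 0 v : ℝ) ^ A * (σ 0 ((v : ℤ) - a).toNat : ℝ) ^ A

/-- `l3Term ≥ 0`. [folklore] -/
theorem l3Term_nonneg (a : ℤ) (A : ℝ) (v : ℕ) : 0 ≤ l3Term a A v := by
  unfold l3Term; positivity

/-- `τ(mn − a)^A ≤ τ(mn)^A τ(mn − a)^A = l3Term(mn)` (`A ≥ 0`, `mn ≥ 1`). [folklore] -/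
theorem rpow_sigma_sub_le_l3Term {a : ℤ} {A : ℝ} (hA : 0 ≤ A) {v : ℕ} (hv : 0 < v) :
    (σ 0 ((v : ℤ) - a).toNat : ℝ) ^ A ≤ l3Term a A v := by
  unfold l3Term
  have h1 : (1 : ℝ) ≤ (σ 0 v : ℝ) ^ A := Real.one_le_rpow (by exact_mod_cast one_le_sigma_zero hv.ne') hA
  have h0 : 0 ≤ (σ 0 ((v : ℤ) - a).toNat : ℝ) ^ A := by positivity
  nlinarith

/-- **Transfer of an `n`-sum in a progression to Lemma 3.**  For `m ≥ 1`, a modulus `D ≥ 1`, a class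
`c (mod D)`, `N ≥ 0`, `A ≥ 0`, and `|a| < m n` for all `n ∼ N`:
`∑_{n∼N, n≡c (D)} τ(mn − a)^A ≤ ∑_{v ∈ l3Set(2mN, mD, m·c̃)} τ(v)^A τ(v−a)^A` where `c̃` is any lift;
here the class of `v = mn` modulo `mD` is `m · c.val`. [folklore] -/
theorem sum_class_rpow_sigma_le_l3 {a : ℤ} {A : ℝ} (hA : 0 ≤ A) {N : ℝ} (hN : 0 ≤ N) {m D : ℕ}
    (hm : 0 < m) (hD : 0 < D) (c : ZMod D) (ha : ∀ n ∈ dyadic N, |a| < ((m * n : ℕ) : ℤ)) :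
    ∑ n ∈ (dyadic N).filter (fun n : ℕ => (n : ZMod D) = c),
        (σ 0 (((m * n : ℕ) : ℤ) - a).toNat : ℝ) ^ A ≤
      ∑ v ∈ l3Set a (2 * m * N) (m * D) ((m * c.val : ℕ) : ZMod (m * D)), l3Term a A v := by
  haveI : NeZero D := ⟨hD.ne'⟩
  -- compare termwise through the injection `n ↦ m n`
  calc ∑ n ∈ (dyadic N).filter (fun n : ℕ => (n : ZMod D) = c),
          (σ 0 (((m * n : ℕ) : ℤ) - a).toNat : ℝ) ^ A
      ≤ ∑ n ∈ (dyadic N).filter (fun n : ℕ => (n : ZMod D) = c), l3Term a A (m * n) := by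
        refine Finset.sum_le_sum fun n hn => ?_
        have hn0 : 0 < n := pos_of_mem_dyadic hN (Finset.mem_filter.1 hn).1
        exact rpow_sigma_sub_le_l3Term hA (Nat.mul_pos hm hn0)
    _ = ∑ v ∈ ((dyadic N).filter (fun n : ℕ => (n : ZMod D) = c)).image (fun n => m * n),
          l3Term a A v := by
        rw [Finset.sum_image]
        intro x _ y _ hxy
        exact Nat.eq_of_mul_eq_mul_left hm hxy
    _ ≤ ∑ v ∈ l3Set a (2 * m * N) (m * D) ((m * c.val : ℕ) : ZMod (m * D)), l3Term a A v := by
        refine Finset.sum_le_sum_of_subset_of_nonneg ?_ fun v _ _ => l3Term_nonneg a A v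
        intro v hv
        rw [Finset.mem_image] at hv
        obtain ⟨n, hn, rfl⟩ := hv
        rw [Finset.mem_filter] at hn
        obtain ⟨hnN, hnc⟩ := hn
        have hn' := (mem_dyadic hN).1 hnN
        have hn0 : 0 < n := pos_of_mem_dyadic hN hnN
        unfold l3Set
        rw [Finset.mem_filter, Finset.mem_Icc]
        refine ⟨⟨Nat.mul_pos hm hn0, Nat.le_floor ?_⟩, ha n hnN, ?_⟩
        · push_cast
          have : (0 : ℝ) < m := by exact_mod_cast hm
          nlinarith [hn'.2]
        · -- `m n ≡ m c.val (mod m D)`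
          have hnc' : n % D = c.val := by
            have := (ZMod.natCast_eq_natCast_iff' n c.val D).1 (by rw [ZMod.natCast_zmod_val]; exact hnc)
            rw [this, Nat.mod_eq_of_lt (ZMod.val_lt c)]
          rw [ZMod.natCast_eq_natCast_iff']
          rw [Nat.mul_mod_mul_left, Nat.mul_mod_mul_left, hnc', Nat.mod_eq_of_lt (ZMod.val_lt c)]

/-- **Transfer of the `m`-sum to Lemma 3.**  For `0 < Y ≤ M`, `M − Y > |a|`, `k ≥ 1`, `A ≥ 0` and a
class `l (mod k)`:
`∑_{m ∈ mRange, m ≡ l (k)} f(m) τ(m)^A ≤ ∑_{v ∈ l3Set(2M+Y, k, l)} τ(v)^A τ(v−a)^A`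
(`f = bump M Y ∈ [0,1]` vanishes for `m ≤ M − Y`). [folklore] -/
theorem sum_mRange_bump_rpow_sigma_le_l3 {a : ℤ} {A : ℝ} (hA : 0 ≤ A) {M Y : ℝ} (hY : 0 < Y)
    (hYM : Y ≤ M) (haM : (|a| : ℝ) < M - Y) {k : ℕ} (l : ZMod k) :
    ∑ m ∈ (mRange M Y).filter (fun m : ℕ => (m : ZMod k) = l), bump M Y m * (σ 0 m : ℝ) ^ A ≤
      ∑ v ∈ l3Set a (2 * M + Y) k l, l3Term a A v := by
  have hM : 0 ≤ M := hY.le.trans hYM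
  -- drop the `m` with `bump = 0`, compare the rest termwise
  have hsub : ((mRange M Y).filter (fun m : ℕ => (m : ZMod k) = l)).filter
      (fun m : ℕ => bump M Y m ≠ 0) ⊆ l3Set a (2 * M + Y) k l := by
    intro m hm
    rw [Finset.mem_filter, Finset.mem_filter, mem_mRange] at hm
    obtain ⟨⟨hmr, hml⟩, hb⟩ := hm
    have hmY : M - Y < (m : ℝ) := by
      by_contra h
      exact hb (bump_eq_zero_of_le hY hM (not_lt.1 h))
    unfold l3Set
    rw [Finset.mem_filter, Finset.mem_Icc]
    refine ⟨⟨?_, hmr⟩, ?_, hml⟩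
    · have : (0 : ℝ) < m := by linarith [abs_nonneg (a : ℝ)]
      exact_mod_cast this
    · have : (|a| : ℝ) < m := by linarith
      exact_mod_cast this
  calc ∑ m ∈ (mRange M Y).filter (fun m : ℕ => (m : ZMod k) = l), bump M Y m * (σ 0 m : ℝ) ^ A
      = ∑ m ∈ ((mRange M Y).filter (fun m : ℕ => (m : ZMod k) = l)).filter
          (fun m : ℕ => bump M Y m ≠ 0), bump M Y m * (σ 0 m : ℝ) ^ A := by
        symm
        refine Finset.sum_filter_of_ne fun m _ hne => ?_
        exact fun h => hne (by rw [h, zero_mul])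
    _ ≤ ∑ v ∈ ((mRange M Y).filter (fun m : ℕ => (m : ZMod k) = l)).filter
          (fun m : ℕ => bump M Y m ≠ 0), l3Term a A v := by
        refine Finset.sum_le_sum fun m hm => ?_
        have hmem := hsub hm
        unfold l3Set at hmem
        rw [Finset.mem_filter, Finset.mem_Icc] at hmem
        have hm0 : 0 < m := hmem.1.1
        unfold l3Term
        have h1 : bump M Y m ≤ 1 := (bump_mem_Icc hY hM _).2
        have h0 : 0 ≤ bump M Y m := (bump_mem_Icc hY hM _).1
        have h2 : (1 : ℝ) ≤ (σ 0 ((m : ℤ) - a).toNat : ℝ) ^ A := by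
          refine Real.one_le_rpow ?_ hA
          have : 1 ≤ ((m : ℤ) - a).toNat := BombieriFriedlanderIwaniecLemma3.one_le_toNat_sub hmem.2.1
          exact_mod_cast one_le_sigma_zero (by omega)
        have h3 : 0 ≤ (σ 0 m : ℝ) ^ A := by positivity
        calc bump M Y m * (σ 0 m : ℝ) ^ A ≤ 1 * (σ 0 m : ℝ) ^ A :=
              mul_le_mul_of_nonneg_right h1 h3
          _ ≤ (σ 0 m : ℝ) ^ A * (σ 0 ((m : ℤ) - a).toNat : ℝ) ^ A := by rw [one_mul]; nlinarith
    _ ≤ _ := Finset.sum_le_sum_of_subset_of_nonneg hsub fun v _ _ => l3Term_nonneg a A v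

/-- **The class count for the `m`-sum**: `∑_{m ∈ mRange, m ≡ l (k)} f(m) ≤ (2M+Y)/k + 1` (`k ≥ 1`).
[folklore] -/
theorem sum_mRange_bump_class_le {M Y : ℝ} (hY : 0 < Y) (hYM : Y ≤ M) {k : ℕ} (hk : 0 < k)
    (l : ZMod k) :
    ∑ m ∈ (mRange M Y).filter (fun m : ℕ => (m : ZMod k) = l), bump M Y m ≤ (2 * M + Y) / k + 1 := by
  have hM : 0 ≤ M := hY.le.trans hYM
  refine (sum_mRange_filter_bump_le_card hY hYM _).trans ?_
  have h := BFILemma3.card_filter_dvd_le ⌊2 * M + Y⌋₊ Nat.one_pos hk l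
  rw [Nat.lcm_one_left] at h
  have hset : (Finset.Icc 1 ⌊2 * M + Y⌋₊).filter (fun m : ℕ => (m : ZMod k) = l) =
      (Finset.Icc 1 ⌊2 * M + Y⌋₊).filter (fun m : ℕ => (m : ZMod k) = l ∧ 1 ∣ m) := by
    refine Finset.filter_congr fun m _ => ?_
    simp
  rw [hset]
  have hL : (⌊2 * M + Y⌋₊ : ℝ) ≤ 2 * M + Y := Nat.floor_le (by linarith)
  calc (#((Finset.Icc 1 ⌊2 * M + Y⌋₊).filter (fun m : ℕ => (m : ZMod k) = l ∧ 1 ∣ m)) : ℝ)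
      ≤ ((⌊2 * M + Y⌋₊ / k + 1 : ℕ) : ℝ) := by exact_mod_cast h
    _ = ((⌊2 * M + Y⌋₊ / k : ℕ) : ℝ) + 1 := by push_cast; ring
    _ ≤ (⌊2 * M + Y⌋₊ : ℝ) / k + 1 := by gcongr; exact Nat.cast_div_le
    _ ≤ (2 * M + Y) / k + 1 := by gcongr

/-- **Divisors of `v` in a dyadic range, weighted**: for `v ≥ 1`, `B ≥ 0`,
`∑_{q ∼ Q, q ∣ v} τ(q)^B ≤ τ(v)^{B+1}`. [folklore] -/
theorem sum_dyadic_dvd_rpow_sigma_le {v : ℕ} (hv : 0 < v) (Q : ℝ) {B : ℝ} (hB : 0 ≤ B) :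
    ∑ q ∈ (dyadic Q).filter (fun q => q ∣ v), (σ 0 q : ℝ) ^ B ≤ (σ 0 v : ℝ) ^ (B + 1) := by
  calc ∑ q ∈ (dyadic Q).filter (fun q => q ∣ v), (σ 0 q : ℝ) ^ B
      ≤ ∑ q ∈ v.divisors, (σ 0 q : ℝ) ^ B := by
        refine Finset.sum_le_sum_of_subset_of_nonneg ?_ fun q _ _ => by positivity
        intro q hq
        rw [Finset.mem_filter] at hq
        exact Nat.mem_divisors.2 ⟨hq.2, hv.ne'⟩
    _ ≤ ∑ q ∈ v.divisors, (σ 0 v : ℝ) ^ B := by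
        refine Finset.sum_le_sum fun q hq => ?_
        exact Real.rpow_le_rpow (by positivity)
          (by exact_mod_cast sigma_zero_le_of_dvd hv.ne' (Nat.dvd_of_mem_divisors hq)) hB
    _ = (σ 0 v : ℝ) * (σ 0 v : ℝ) ^ B := by
        rw [Finset.sum_const, nsmul_eq_mul, ← ArithmeticFunction.sigma_zero_apply]
    _ = (σ 0 v : ℝ) ^ (B + 1) := by
        have hpos : (0 : ℝ) < (σ 0 v : ℝ) := by exact_mod_cast one_le_sigma_zero hv.ne'
        rw [Real.rpow_add_one hpos.ne', mul_comm]


/-! ### Rearranging the off-range sums: `m` outside, `(q₂, n₂)` inside -/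

/-- The inner `(q₂, n₂)`-sum of the off-range sums for fixed `(m, r, q₁, n₁)`:
`∑_{q₂∼Q} ∑_{n₂∼N} [P(q₁,q₂,n₁,n₂)] [mn₂ ≡ a (q₂r)] |γ_{q₂}|`. [folklore] -/
def innerP (a : ℤ) (N Q : ℝ) (γ : ℕ → ℝ) (P : ℕ → ℕ → ℕ → ℕ → Prop)
    [∀ q₁ q₂ n₁ n₂, Decidable (P q₁ q₂ n₁ n₂)] (m r q₁ n₁ : ℕ) : ℝ :=
  ∑ q₂ ∈ dyadic Q, ∑ n₂ ∈ dyadic N,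
    if P q₁ q₂ n₁ n₂ ∧ ((m * n₂ : ℕ) : ZMod (q₂ * r)) = (a : ZMod (q₂ * r)) then |γ q₂| else 0

/-- `innerP ≥ 0`. [folklore] -/
theorem innerP_nonneg (a : ℤ) (N Q : ℝ) (γ : ℕ → ℝ) (P : ℕ → ℕ → ℕ → ℕ → Prop)
    [∀ q₁ q₂ n₁ n₂, Decidable (P q₁ q₂ n₁ n₂)] (m r q₁ n₁ : ℕ) : 0 ≤ innerP a N Q γ P m r q₁ n₁ :=
  Finset.sum_nonneg fun _ _ => Finset.sum_nonneg fun _ _ => by split_ifs <;> positivity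

/-- **Rearrangement**: `restSum[P] = ∑_{r,q₁,n₁} ∑_{m ∈ S} [(q₁r,a)=1][mn₁≡a (q₁r)] |γ_{q₁}| β_{n₁}² w(m) ·
innerP[P](m,r,q₁,n₁)`. [folklore] -/
theorem restSum_eq (a : ℤ) (S : Finset ℕ) (N Q R : ℝ) (w β γ : ℕ → ℝ)
    (P : ℕ → ℕ → ℕ → ℕ → Prop) [∀ q₁ q₂ n₁ n₂, Decidable (P q₁ q₂ n₁ n₂)] :
    restSum a S N Q R w β γ P = ∑ r ∈ dyadic R, ∑ q₁ ∈ dyadic Q, ∑ n₁ ∈ dyadic N, ∑ m ∈ S,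
      if IsCoprime ((q₁ * r : ℕ) : ℤ) a ∧ ((m * n₁ : ℕ) : ZMod (q₁ * r)) = (a : ZMod (q₁ * r)) then
        |γ q₁| * β n₁ ^ 2 * w m * innerP a N Q γ P m r q₁ n₁ else 0 := by
  unfold restSum
  refine Finset.sum_congr rfl fun r _ => Finset.sum_congr rfl fun q₁ _ => ?_
  -- LHS at fixed `(r, q₁)`: `∑_{q₂} ∑_{n₁} ∑_{n₂} [P] |γ₁||γ₂| β₁² mB`
  rw [Finset.sum_comm]
  refine Finset.sum_congr rfl fun n₁ _ => ?_
  -- now `∑_{q₂} ∑_{n₂} [P] … mB = ∑_m [c₀c₁] … innerP`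
  have e1 : ∀ q₂ n₂, (if P q₁ q₂ n₁ n₂ then |γ q₁| * |γ q₂| * β n₁ ^ 2 * mB a S w r q₁ q₂ n₁ n₂
      else 0) = ∑ m ∈ S, (if P q₁ q₂ n₁ n₂ then |γ q₁| * |γ q₂| * β n₁ ^ 2 *
        (if IsCoprime ((q₁ * r : ℕ) : ℤ) a ∧ ((m * n₁ : ℕ) : ZMod (q₁ * r)) = (a : ZMod (q₁ * r)) ∧
          ((m * n₂ : ℕ) : ZMod (q₂ * r)) = (a : ZMod (q₂ * r)) then w m else 0) else 0) := by
    intro q₂ n₂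
    split_ifs
    · unfold mB; rw [Finset.mul_sum]
    · simp
  simp_rw [e1]
  -- move `m` outside
  rw [Finset.sum_congr rfl fun q₂ _ => Finset.sum_comm, Finset.sum_comm]
  refine Finset.sum_congr rfl fun m _ => ?_
  by_cases hc : IsCoprime ((q₁ * r : ℕ) : ℤ) a ∧ ((m * n₁ : ℕ) : ZMod (q₁ * r)) = (a : ZMod (q₁ * r))
  · rw [if_pos hc]
    unfold innerP
    rw [Finset.mul_sum]
    refine Finset.sum_congr rfl fun q₂ _ => ?_
    rw [Finset.mul_sum]
    refine Finset.sum_congr rfl fun n₂ _ => ?_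
    by_cases hP : P q₁ q₂ n₁ n₂
    · by_cases h2 : ((m * n₂ : ℕ) : ZMod (q₂ * r)) = (a : ZMod (q₂ * r))
      · rw [if_pos hP, if_pos ⟨hc.1, hc.2, h2⟩, if_pos ⟨hP, h2⟩]; ring
      · rw [if_pos hP, if_neg (fun h => h2 h.2.2), if_neg (fun h => h2 h.2)]; ring
    · rw [if_neg hP, if_neg (fun h => hP h.1), mul_zero]
  · rw [if_neg hc]
    refine Finset.sum_eq_zero fun q₂ _ => Finset.sum_eq_zero fun n₂ _ => ?_
    split_ifs with hP h3
    · exact absurd ⟨h3.1, h3.2.1⟩ hc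
    · ring
    · rfl

/-- **Generic bound for the off-range sums**: a pointwise bound `innerP ≤ G` on the relevant
`(m, r, q₁, n₁)` (`w(m) ≠ 0`, `(q₁r,a)=1`, `mn₁ ≡ a (q₁r)`) gives
`restSum[P] ≤ ∑_{r,q₁,n₁} [(q₁r,a)=1] |γ_{q₁}| β_{n₁}² ∑_{m ∈ S, mn₁≡a (q₁r)} w(m) G(m,r,q₁,n₁)` (`w ≥ 0`).
[folklore] -/
theorem restSum_le_of_innerP_le (a : ℤ) {S : Finset ℕ} (N Q R : ℝ) {w : ℕ → ℝ}
    (hw : ∀ m ∈ S, 0 ≤ w m) (β γ : ℕ → ℝ) (P : ℕ → ℕ → ℕ → ℕ → Prop)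
    [∀ q₁ q₂ n₁ n₂, Decidable (P q₁ q₂ n₁ n₂)] {G : ℕ → ℕ → ℕ → ℕ → ℝ}
    (hG : ∀ r ∈ dyadic R, ∀ q₁ ∈ dyadic Q, ∀ n₁ ∈ dyadic N, β n₁ ≠ 0 → ∀ m ∈ S, w m ≠ 0 →
      IsCoprime ((q₁ * r : ℕ) : ℤ) a → ((m * n₁ : ℕ) : ZMod (q₁ * r)) = (a : ZMod (q₁ * r)) →
      innerP a N Q γ P m r q₁ n₁ ≤ G m r q₁ n₁) :
    restSum a S N Q R w β γ P ≤ ∑ r ∈ dyadic R, ∑ q₁ ∈ dyadic Q, ∑ n₁ ∈ dyadic N,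
      if IsCoprime ((q₁ * r : ℕ) : ℤ) a then
        |γ q₁| * β n₁ ^ 2 * ∑ m ∈ S.filter (fun m : ℕ => ((m * n₁ : ℕ) : ZMod (q₁ * r)) = (a : ZMod (q₁ * r))),
          w m * G m r q₁ n₁ else 0 := by
  rw [restSum_eq]
  refine Finset.sum_le_sum fun r hr => Finset.sum_le_sum fun q₁ hq₁ => Finset.sum_le_sum fun n₁ hn₁ => ?_
  by_cases hc₀ : IsCoprime ((q₁ * r : ℕ) : ℤ) a
  · rw [if_pos hc₀, Finset.mul_sum, Finset.sum_filter]
    refine Finset.sum_le_sum fun m hm => ?_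
    by_cases hc : ((m * n₁ : ℕ) : ZMod (q₁ * r)) = (a : ZMod (q₁ * r))
    · rw [if_pos ⟨hc₀, hc⟩, if_pos hc]
      by_cases hwm : w m = 0
      · rw [hwm]; simp
      by_cases hβ0 : β n₁ = 0
      · rw [hβ0]; simp
      · have := hG r hr q₁ hq₁ n₁ hn₁ hβ0 m hm hwm hc₀ hc
        have hw0 := hw m hm
        have : |γ q₁| * β n₁ ^ 2 * w m * innerP a N Q γ P m r q₁ n₁ ≤
            |γ q₁| * β n₁ ^ 2 * w m * G m r q₁ n₁ :=
          mul_le_mul_of_nonneg_left this (by positivity)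
        linarith
    · rw [if_neg (fun h => hc h.2), if_neg hc]
  · rw [if_neg hc₀]
    refine le_of_eq (Finset.sum_eq_zero fun m _ => if_neg (fun h => hc₀ h.1))


/-! ### Counting a residue class in a dyadic range -/

/-- `#{n ∼ N : n ≡ c (D)} ≤ 2N/D + 1` for every class `c` (`D ≥ 1`, `N ≥ 0`). [folklore] -/
theorem card_dyadic_class_le {N : ℝ} (hN : 0 ≤ N) {D : ℕ} (hD : 0 < D) (c : ZMod D) :
    (#((dyadic N).filter (fun n : ℕ => (n : ZMod D) = c)) : ℝ) ≤ 2 * N / D + 1 := by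
  have h := BFILemma3.card_filter_dvd_le ⌊2 * N⌋₊ Nat.one_pos hD c
  rw [Nat.lcm_one_left] at h
  have hsub : (dyadic N).filter (fun n : ℕ => (n : ZMod D) = c) ⊆
      (Finset.Icc 1 ⌊2 * N⌋₊).filter (fun n : ℕ => (n : ZMod D) = c ∧ 1 ∣ n) := by
    intro n hn
    rw [Finset.mem_filter] at hn ⊢
    exact ⟨dyadic_subset_Icc hN hn.1, hn.2, one_dvd n⟩
  have hL : (⌊2 * N⌋₊ : ℝ) ≤ 2 * N := Nat.floor_le (by linarith)
  calc (#((dyadic N).filter (fun n : ℕ => (n : ZMod D) = c)) : ℝ)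
      ≤ (#((Finset.Icc 1 ⌊2 * N⌋₊).filter (fun n : ℕ => (n : ZMod D) = c ∧ 1 ∣ n)) : ℝ) := by
        exact_mod_cast Finset.card_le_card hsub
    _ ≤ ((⌊2 * N⌋₊ / D + 1 : ℕ) : ℝ) := by exact_mod_cast h
    _ = ((⌊2 * N⌋₊ / D : ℕ) : ℝ) + 1 := by push_cast; ring
    _ ≤ (⌊2 * N⌋₊ : ℝ) / D + 1 := by gcongr; exact Nat.cast_div_le
    _ ≤ 2 * N / D + 1 := by gcongr

/-! ### The inner bound for the pairs with a common factor (BFI (6.4)) -/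

/-- `[¬(n₁,n₂)=1] ≤ ∑_{p ∣ n₁ prime} [p ∣ n₂]` (as an inequality of nonnegative weights). [folklore] -/
theorem ite_not_coprime_le_sum_primeFactors {n₁ n₂ : ℕ} (hn₁ : n₁ ≠ 0) {x : ℝ} (hx : 0 ≤ x) :
    (if ¬n₁.Coprime n₂ then x else 0) ≤ ∑ p ∈ n₁.primeFactors, if p ∣ n₂ then x else 0 := by
  by_cases h : n₁.Coprime n₂
  · rw [if_neg (not_not_intro h)]
    exact Finset.sum_nonneg fun p _ => by positivity
  · rw [if_pos h]
    -- a prime factor of `gcd(n₁,n₂)`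
    have hg : Nat.gcd n₁ n₂ ≠ 1 := h
    obtain ⟨p, hp, hpd⟩ := Nat.exists_prime_and_dvd hg
    have hp₁ : p ∈ n₁.primeFactors :=
      Nat.mem_primeFactors.2 ⟨hp, hpd.trans (Nat.gcd_dvd_left _ _), hn₁⟩
    have hp₂ : p ∣ n₂ := hpd.trans (Nat.gcd_dvd_right _ _)
    calc x = if p ∣ n₂ then x else 0 := by rw [if_pos hp₂]
      _ ≤ ∑ p ∈ n₁.primeFactors, if p ∣ n₂ then x else 0 :=
          Finset.single_le_sum (f := fun p => if p ∣ n₂ then x else 0)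
            (fun p _ => by positivity) hp₁

/-- The `q₂`-sum at fixed `n₂`: with `v = mn₂ − a ≥ 1`,
`∑_{q₂∼Q, q₂r ∣ v} |γ_{q₂}| ≤ [r ∣ v] τ(v)^{B+1}` for `|γ_q| ≤ τ(q)^B`. [folklore] -/
theorem sum_dyadic_cong_abs_le {a : ℤ} {Q B : ℝ} (hB : 0 ≤ B) {γ : ℕ → ℝ}
    (hγ : ∀ q, |γ q| ≤ (σ 0 q : ℝ) ^ B) {m r n₂ : ℕ} (hv : a < ((m * n₂ : ℕ) : ℤ)) :
    ∑ q₂ ∈ dyadic Q, (if ((m * n₂ : ℕ) : ZMod (q₂ * r)) = (a : ZMod (q₂ * r)) then |γ q₂| else 0) ≤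
      if r ∣ (((m * n₂ : ℕ) : ℤ) - a).toNat then
        (σ 0 (((m * n₂ : ℕ) : ℤ) - a).toNat : ℝ) ^ (B + 1) else 0 := by
  set v : ℕ := (((m * n₂ : ℕ) : ℤ) - a).toNat with hvdef
  have hv0 : 0 < v := by rw [hvdef]; omega
  have hvZ : (v : ℤ) = ((m * n₂ : ℕ) : ℤ) - a := by rw [hvdef]; omega
  -- the congruence means `q₂ r ∣ v`
  have hcong : ∀ q₂, ((m * n₂ : ℕ) : ZMod (q₂ * r)) = (a : ZMod (q₂ * r)) → q₂ * r ∣ v := by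
    intro q₂ h
    have h' : (((m * n₂ : ℕ) : ℤ) : ZMod (q₂ * r)) = ((a : ℤ) : ZMod (q₂ * r)) := by exact_mod_cast h
    rw [ZMod.intCast_eq_intCast_iff_dvd_sub] at h'
    -- `(q₂ r : ℤ) ∣ a - m n₂`
    have h2 : ((q₂ * r : ℕ) : ℤ) ∣ (v : ℤ) := by
      rw [hvZ]
      have := h'.neg_right
      rwa [neg_sub] at this
    exact_mod_cast h2
  by_cases hr : r ∣ v
  · rw [if_pos hr]
    calc ∑ q₂ ∈ dyadic Q, (if ((m * n₂ : ℕ) : ZMod (q₂ * r)) = (a : ZMod (q₂ * r)) then |γ q₂| else 0)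
        ≤ ∑ q₂ ∈ dyadic Q, (if q₂ ∣ v then (σ 0 q₂ : ℝ) ^ B else 0) := by
          refine Finset.sum_le_sum fun q₂ _ => ?_
          split_ifs with h1 h2
          · exact hγ q₂
          · exact absurd ((dvd_mul_right q₂ r).trans (hcong q₂ h1)) h2
          · positivity
          · exact le_rfl
      _ = ∑ q₂ ∈ (dyadic Q).filter (fun q => q ∣ v), (σ 0 q₂ : ℝ) ^ B := (Finset.sum_filter _ _).symm
      _ ≤ (σ 0 v : ℝ) ^ (B + 1) := sum_dyadic_dvd_rpow_sigma_le hv0 Q hB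
  · rw [if_neg hr]
    refine le_of_eq (Finset.sum_eq_zero fun q₂ _ => ?_)
    rw [if_neg]
    intro h
    exact hr ((dvd_mul_left r q₂).trans (hcong q₂ h))

/-- **The inner bound for the pairs `(n₁, n₂) > 1`** (BFI (6.4) p. 220: "If `(n₁,n₂) > 1` then,
by (A₄), there exists `p > N₀` such that `n₁ = pn₁'`, `n₂ = pn₂'` …"): for `m, r ≥ 1` with
`(m, r) = (n₁, r) = 1`, `n₁ ≠ 0`, `|γ_q| ≤ τ(q)^B`, `|a| < mn` on `n ∼ N`, a Lemma-3 bound `hL3`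
(exponent `B+1`, constants `C₃, B₃`, threshold `X₀ ≤ 2mN`, level `mpr ≤ (2mN)^{1−ε₃}` for the
primes `p ≤ P₀`), and a uniform bound `T` for `τ(mn−a)^{B+1}`:
`innerP[(n₁,n₂)>1](m,r,q₁,n₁) ≤ ∑_{p∣n₁} { C₃ (2mN/(mpr)) (τ(mpr) log 2mN)^{B₃}  (p ≤ P₀);
T (2N/(P₀R)+1) (p > P₀) }`. [cite: BombieriFriedlanderIwaniecActa1986, §6 (6.4) p. 220] -/
theorem innerP_ncop_le {a : ℤ} {N Q R B : ℝ} (hN : 0 ≤ N) (hR : 0 < R) (hB : 0 ≤ B) {γ : ℕ → ℝ}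
    (hγ : ∀ q, |γ q| ≤ (σ 0 q : ℝ) ^ B) {m r q₁ n₁ : ℕ} (hm : 0 < m) (hr : 0 < r) (hRr : R ≤ r)
    (hmr : m.Coprime r) (hn₁ : n₁ ≠ 0) (hn₁r : n₁.Coprime r)
    (ha : ∀ n ∈ dyadic N, |a| < ((m * n : ℕ) : ℤ))
    {C₃ B₃ X₀ ε₃ P₀ T : ℝ} (hP₀ : 0 < P₀) (hT : 0 ≤ T)
    (hL3 : ∀ X : ℝ, X₀ ≤ X → ∀ k : ℕ, 0 < k → (k : ℝ) ≤ X ^ (1 - ε₃) → ∀ l : ZMod k,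
      ∑ v ∈ l3Set a X k l, l3Term a (B + 1) v ≤ C₃ * (X / k) * ((σ 0 k : ℝ) * Real.log X) ^ B₃)
    (hX₀ : X₀ ≤ 2 * m * N)
    (hlev : ∀ p ∈ n₁.primeFactors, (p : ℝ) ≤ P₀ → ((m * (p * r) : ℕ) : ℝ) ≤ (2 * m * N) ^ (1 - ε₃))
    (hTv : ∀ n ∈ dyadic N, (σ 0 (((m * n : ℕ) : ℤ) - a).toNat : ℝ) ^ (B + 1) ≤ T) :
    innerP a N Q γ (fun _ _ n₁' n₂ => ¬n₁'.Coprime n₂) m r q₁ n₁ ≤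
      ∑ p ∈ n₁.primeFactors,
        (if (p : ℝ) ≤ P₀ then
          C₃ * (2 * m * N / ((m * (p * r) : ℕ) : ℝ)) *
            ((σ 0 (m * (p * r)) : ℝ) * Real.log (2 * m * N)) ^ B₃
        else T * (2 * N / (P₀ * R) + 1)) := by
  classical
  unfold innerP
  -- Step 1: the `q₂`-sum, then `[¬cop] ≤ ∑_p [p ∣ n₂]`
  set v : ℕ → ℕ := fun n₂ => (((m * n₂ : ℕ) : ℤ) - a).toNat with hvdef
  have hstep1 : ∀ n₂ ∈ dyadic N,
      ∑ q₂ ∈ dyadic Q, (if ¬n₁.Coprime n₂ ∧ ((m * n₂ : ℕ) : ZMod (q₂ * r)) = (a : ZMod (q₂ * r))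
        then |γ q₂| else 0) ≤
      ∑ p ∈ n₁.primeFactors, (if p ∣ n₂ ∧ r ∣ v n₂ then (σ 0 (v n₂) : ℝ) ^ (B + 1) else 0) := by
    intro n₂ hn₂
    have hva : a < ((m * n₂ : ℕ) : ℤ) := lt_of_le_of_lt (le_abs_self a) (ha n₂ hn₂)
    by_cases hc : n₁.Coprime n₂
    · rw [Finset.sum_eq_zero fun q₂ _ => if_neg (fun h => h.1 hc)]
      exact Finset.sum_nonneg fun p _ => by positivity
    · calc ∑ q₂ ∈ dyadic Q, (if ¬n₁.Coprime n₂ ∧ ((m * n₂ : ℕ) : ZMod (q₂ * r)) = (a : ZMod (q₂ * r))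
            then |γ q₂| else 0)
          = ∑ q₂ ∈ dyadic Q, (if ((m * n₂ : ℕ) : ZMod (q₂ * r)) = (a : ZMod (q₂ * r))
            then |γ q₂| else 0) := Finset.sum_congr rfl fun q₂ _ => by simp [hc]
        _ ≤ if r ∣ v n₂ then (σ 0 (v n₂) : ℝ) ^ (B + 1) else 0 := sum_dyadic_cong_abs_le hB hγ hva
        _ = if ¬n₁.Coprime n₂ then (if r ∣ v n₂ then (σ 0 (v n₂) : ℝ) ^ (B + 1) else 0) else 0 := by
            rw [if_pos hc]
        _ ≤ ∑ p ∈ n₁.primeFactors, if p ∣ n₂ then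
              (if r ∣ v n₂ then (σ 0 (v n₂) : ℝ) ^ (B + 1) else 0) else 0 :=
            ite_not_coprime_le_sum_primeFactors hn₁ (by positivity)
        _ = _ := Finset.sum_congr rfl fun p _ => by
            by_cases h1 : p ∣ n₂ <;> by_cases h2 : r ∣ v n₂ <;> simp [h1, h2]
  rw [Finset.sum_comm]
  refine (Finset.sum_le_sum hstep1).trans ?_
  rw [Finset.sum_comm]
  refine Finset.sum_le_sum fun p hp => ?_
  -- Step 2: for a fixed prime `p ∣ n₁`, all `n₂` with `p ∣ n₂`, `r ∣ mn₂ − a` lie in one class mod `pr`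
  have hpP := Nat.prime_of_mem_primeFactors hp
  have hpn₁ : p ∣ n₁ := Nat.dvd_of_mem_primeFactors hp
  have hpr : p.Coprime r := Nat.Coprime.coprime_dvd_left hpn₁ hn₁r
  have hD : 0 < p * r := Nat.mul_pos hpP.pos hr
  set Tp := (dyadic N).filter (fun n₂ => p ∣ n₂ ∧ r ∣ v n₂) with hTp
  have hclass : ∃ c : ZMod (p * r), Tp ⊆ (dyadic N).filter (fun n : ℕ => (n : ZMod (p * r)) = c) := by
    by_cases hne : Tp.Nonempty
    · obtain ⟨n₀, hn₀⟩ := hne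
      refine ⟨(n₀ : ZMod (p * r)), fun n hn => ?_⟩
      rw [hTp, Finset.mem_filter] at hn hn₀
      rw [Finset.mem_filter]
      refine ⟨hn.1, ?_⟩
      -- `p r ∣ n − n₀`
      have h1 : (p : ℤ) ∣ (n : ℤ) - n₀ := by
        have := Int.natCast_dvd_natCast.2 hn.2.1
        have := Int.natCast_dvd_natCast.2 hn₀.2.1
        exact Int.dvd_sub ‹(p : ℤ) ∣ (n : ℤ)› (Int.natCast_dvd_natCast.2 hn₀.2.1)
      have hva : ∀ n' ∈ dyadic N, ((v n' : ℕ) : ℤ) = ((m * n' : ℕ) : ℤ) - a := by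
        intro n' hn'
        have := lt_of_le_of_lt (le_abs_self a) (ha n' hn')
        simp only [hvdef]; omega
      have h2 : (r : ℤ) ∣ (n : ℤ) - n₀ := by
        have e1 : (r : ℤ) ∣ ((m * n : ℕ) : ℤ) - a := by
          rw [← hva n hn.1]; exact Int.natCast_dvd_natCast.2 hn.2.2
        have e2 : (r : ℤ) ∣ ((m * n₀ : ℕ) : ℤ) - a := by
          rw [← hva n₀ hn₀.1]; exact Int.natCast_dvd_natCast.2 hn₀.2.2
        have e3 : (r : ℤ) ∣ (m : ℤ) * ((n : ℤ) - n₀) := by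
          have := Int.dvd_sub e1 e2
          have e : ((m * n : ℕ) : ℤ) - a - (((m * n₀ : ℕ) : ℤ) - a) = (m : ℤ) * ((n : ℤ) - n₀) := by
            push_cast; ring
          rwa [e] at this
        exact (Nat.isCoprime_iff_coprime.2 hmr.symm).dvd_of_dvd_mul_left e3
      have h3 : ((p * r : ℕ) : ℤ) ∣ (n : ℤ) - n₀ := by
        push_cast
        exact (Nat.isCoprime_iff_coprime.2 hpr).mul_dvd h1 h2
      have := (ZMod.intCast_eq_intCast_iff_dvd_sub (n₀ : ℤ) (n : ℤ) (p * r)).2 h3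
      push_cast at this
      exact this.symm
    · refine ⟨0, fun n hn => absurd ⟨n, hn⟩ hne⟩
  obtain ⟨c, hsub⟩ := hclass
  have hSp : ∑ n₂ ∈ dyadic N, (if p ∣ n₂ ∧ r ∣ v n₂ then (σ 0 (v n₂) : ℝ) ^ (B + 1) else 0) ≤
      ∑ n₂ ∈ (dyadic N).filter (fun n : ℕ => (n : ZMod (p * r)) = c),
        (σ 0 (((m * n₂ : ℕ) : ℤ) - a).toNat : ℝ) ^ (B + 1) := by
    rw [← Finset.sum_filter]
    exact Finset.sum_le_sum_of_subset_of_nonneg hsub fun n _ _ => by positivity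
  refine hSp.trans ?_
  by_cases hpP₀ : (p : ℝ) ≤ P₀
  · rw [if_pos hpP₀]
    haveI : NeZero (p * r) := ⟨hD.ne'⟩
    refine (sum_class_rpow_sigma_le_l3 (by linarith) hN hm hD c ha).trans ?_
    have hk : 0 < m * (p * r) := Nat.mul_pos hm hD
    have := hL3 (2 * m * N) hX₀ (m * (p * r)) hk (hlev p hp hpP₀)
      ((m * c.val : ℕ) : ZMod (m * (p * r)))
    exact this
  · rw [if_neg hpP₀]
    calc ∑ n₂ ∈ (dyadic N).filter (fun n : ℕ => (n : ZMod (p * r)) = c),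
          (σ 0 (((m * n₂ : ℕ) : ℤ) - a).toNat : ℝ) ^ (B + 1)
        ≤ ∑ n₂ ∈ (dyadic N).filter (fun n : ℕ => (n : ZMod (p * r)) = c), T :=
          Finset.sum_le_sum fun n₂ hn₂ => hTv n₂ (Finset.mem_filter.1 hn₂).1
      _ = #((dyadic N).filter (fun n : ℕ => (n : ZMod (p * r)) = c)) * T := by
          rw [Finset.sum_const, nsmul_eq_mul]
      _ ≤ (2 * N / ((p * r : ℕ) : ℝ) + 1) * T :=
          mul_le_mul_of_nonneg_right (card_dyadic_class_le hN hD c) hT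
      _ ≤ (2 * N / (P₀ * R) + 1) * T := by
          refine mul_le_mul_of_nonneg_right ?_ hT
          have hp' : P₀ < p := not_le.1 hpP₀
          have : P₀ * R ≤ ((p * r : ℕ) : ℝ) := by
            push_cast
            exact mul_le_mul hp'.le hRr hR.le (by positivity)
          have hPR : 0 < P₀ * R := mul_pos hP₀ hR
          gcongr
      _ = T * (2 * N / (P₀ * R) + 1) := mul_comm _ _


/-! ### The inner bound for the moduli with `(q₁, q₂) > Q₀` (BFI (6.3)) -/

/-- The `n ∼ N` with `D ∣ mn − a` lie in a single class modulo `D` when `(m, D) = 1`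
(`|a| < mn` on the range). [folklore] -/
theorem exists_class_of_dvd {a : ℤ} {N : ℝ} {m D : ℕ} (hmD : m.Coprime D)
    (ha : ∀ n ∈ dyadic N, |a| < ((m * n : ℕ) : ℤ)) :
    ∃ c : ZMod D, (dyadic N).filter (fun n : ℕ => D ∣ (((m * n : ℕ) : ℤ) - a).toNat) ⊆
      (dyadic N).filter (fun n : ℕ => (n : ZMod D) = c) := by
  classical
  set Tset := (dyadic N).filter (fun n : ℕ => D ∣ (((m * n : ℕ) : ℤ) - a).toNat) with hT
  have hva : ∀ n' ∈ dyadic N, (((((m * n' : ℕ) : ℤ) - a).toNat : ℕ) : ℤ) = ((m * n' : ℕ) : ℤ) - a := by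
    intro n' hn'
    have := lt_of_le_of_lt (le_abs_self a) (ha n' hn')
    omega
  by_cases hne : Tset.Nonempty
  · obtain ⟨n₀, hn₀⟩ := hne
    refine ⟨(n₀ : ZMod D), fun n hn => ?_⟩
    rw [hT, Finset.mem_filter] at hn hn₀
    rw [Finset.mem_filter]
    refine ⟨hn.1, ?_⟩
    have e1 : (D : ℤ) ∣ ((m * n : ℕ) : ℤ) - a := by
      rw [← hva n hn.1]; exact Int.natCast_dvd_natCast.2 hn.2
    have e2 : (D : ℤ) ∣ ((m * n₀ : ℕ) : ℤ) - a := by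
      rw [← hva n₀ hn₀.1]; exact Int.natCast_dvd_natCast.2 hn₀.2
    have e3 : (D : ℤ) ∣ (m : ℤ) * ((n : ℤ) - n₀) := by
      have := Int.dvd_sub e1 e2
      have e : ((m * n : ℕ) : ℤ) - a - (((m * n₀ : ℕ) : ℤ) - a) = (m : ℤ) * ((n : ℤ) - n₀) := by
        push_cast; ring
      rwa [e] at this
    have h3 : (D : ℤ) ∣ (n : ℤ) - n₀ := (Nat.isCoprime_iff_coprime.2 hmD.symm).dvd_of_dvd_mul_left e3
    have := (ZMod.intCast_eq_intCast_iff_dvd_sub (n₀ : ℤ) (n : ℤ) D).2 h3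
    push_cast at this
    exact this.symm
  · exact ⟨0, fun n hn => absurd ⟨n, hn⟩ hne⟩

/-- The `q₂`-sum at fixed `n₂` with the condition `(q₁,q₂) > Q₀`: with `v = mn₂ − a ≥ 1`, `q₁ ≠ 0`,
`∑_{q₂∼Q, (q₁,q₂)>Q₀, q₂r ∣ v} |γ_{q₂}| ≤ ∑_{g ∣ q₁, g > Q₀} [gr ∣ v] τ(v)^{B+1}`. [folklore] -/
theorem sum_dyadic_cong_gcd_abs_le {a : ℤ} {Q Q₀ B : ℝ} (hB : 0 ≤ B) {γ : ℕ → ℝ}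
    (hγ : ∀ q, |γ q| ≤ (σ 0 q : ℝ) ^ B) {m r q₁ n₂ : ℕ} (hq₁ : q₁ ≠ 0)
    (hv : a < ((m * n₂ : ℕ) : ℤ)) :
    ∑ q₂ ∈ dyadic Q, (if ¬((Nat.gcd q₁ q₂ : ℝ) ≤ Q₀) ∧
        ((m * n₂ : ℕ) : ZMod (q₂ * r)) = (a : ZMod (q₂ * r)) then |γ q₂| else 0) ≤
      ∑ g ∈ q₁.divisors, if Q₀ < (g : ℝ) ∧ g * r ∣ (((m * n₂ : ℕ) : ℤ) - a).toNat then
        (σ 0 (((m * n₂ : ℕ) : ℤ) - a).toNat : ℝ) ^ (B + 1) else 0 := by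
  classical
  set v : ℕ := (((m * n₂ : ℕ) : ℤ) - a).toNat with hvdef
  have hv0 : 0 < v := by rw [hvdef]; omega
  have hvZ : (v : ℤ) = ((m * n₂ : ℕ) : ℤ) - a := by rw [hvdef]; omega
  have hcong : ∀ q₂, ((m * n₂ : ℕ) : ZMod (q₂ * r)) = (a : ZMod (q₂ * r)) → q₂ * r ∣ v := by
    intro q₂ h
    have h' : (((m * n₂ : ℕ) : ℤ) : ZMod (q₂ * r)) = ((a : ℤ) : ZMod (q₂ * r)) := by exact_mod_cast h
    rw [ZMod.intCast_eq_intCast_iff_dvd_sub] at h'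
    have h2 : ((q₂ * r : ℕ) : ℤ) ∣ (v : ℤ) := by
      rw [hvZ]
      have := h'.neg_right
      rwa [neg_sub] at this
    exact_mod_cast h2
  -- pointwise: the term at `q₂` is bounded by the `g = gcd(q₁,q₂)` term of the double sum
  have hpt : ∀ q₂ ∈ dyadic Q, (if ¬((Nat.gcd q₁ q₂ : ℝ) ≤ Q₀) ∧
      ((m * n₂ : ℕ) : ZMod (q₂ * r)) = (a : ZMod (q₂ * r)) then |γ q₂| else 0) ≤
      ∑ g ∈ q₁.divisors, if Q₀ < (g : ℝ) ∧ g * r ∣ v then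
        (if q₂ ∣ v then (σ 0 q₂ : ℝ) ^ B else 0) else 0 := by
    intro q₂ _
    have hnn : ∀ g : ℕ, 0 ≤ (if Q₀ < (g : ℝ) ∧ g * r ∣ v then
        (if q₂ ∣ v then (σ 0 q₂ : ℝ) ^ B else 0) else 0 : ℝ) := by
      intro g
      by_cases h1 : Q₀ < (g : ℝ) ∧ g * r ∣ v
      · rw [if_pos h1]
        by_cases h2 : q₂ ∣ v
        · rw [if_pos h2]; positivity
        · rw [if_neg h2]
      · rw [if_neg h1]
    by_cases h : ¬((Nat.gcd q₁ q₂ : ℝ) ≤ Q₀) ∧ ((m * n₂ : ℕ) : ZMod (q₂ * r)) = (a : ZMod (q₂ * r))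
    · rw [if_pos h]
      obtain ⟨hQ₀, hc⟩ := h
      have hdv := hcong q₂ hc
      have hg : Nat.gcd q₁ q₂ ∈ q₁.divisors := Nat.mem_divisors.2 ⟨Nat.gcd_dvd_left _ _, hq₁⟩
      have hgr : Nat.gcd q₁ q₂ * r ∣ v :=
        (Nat.mul_dvd_mul_right (Nat.gcd_dvd_right q₁ q₂) r).trans hdv
      have hq₂v : q₂ ∣ v := (dvd_mul_right q₂ r).trans hdv
      calc |γ q₂| ≤ (σ 0 q₂ : ℝ) ^ B := hγ q₂
        _ = (if Q₀ < (Nat.gcd q₁ q₂ : ℝ) ∧ Nat.gcd q₁ q₂ * r ∣ v then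
              (if q₂ ∣ v then (σ 0 q₂ : ℝ) ^ B else 0) else 0) := by
            rw [if_pos ⟨not_le.1 hQ₀, hgr⟩, if_pos hq₂v]
        _ ≤ _ := Finset.single_le_sum (f := fun g : ℕ => if Q₀ < (g : ℝ) ∧ g * r ∣ v then
              (if q₂ ∣ v then (σ 0 q₂ : ℝ) ^ B else 0) else 0)
            (fun g _ => hnn g) hg
    · rw [if_neg h]
      exact Finset.sum_nonneg fun g _ => hnn g
  refine (Finset.sum_le_sum hpt).trans ?_
  rw [Finset.sum_comm]
  refine Finset.sum_le_sum fun g _ => ?_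
  by_cases hg : Q₀ < (g : ℝ) ∧ g * r ∣ v
  · simp only [if_pos hg]
    rw [← Finset.sum_filter]
    exact sum_dyadic_dvd_rpow_sigma_le hv0 Q hB
  · simp only [if_neg hg, Finset.sum_const_zero, le_refl]

/-- **The inner bound for the moduli `(q₁, q₂) > Q₀`** (BFI (6.3) p. 220: "`𝒮₁(q₀ > Q₀) ≪ ∑_{q₀>Q₀}
∑_r ∑_{(q₁,q₂)=1} |γγ| ∑_{n₁} |β_{n₁}|² ∑_{m} ∑_{n₂} 1` … the innermost sum is … `≪ N(q₀r)⁻¹ℒ^B +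
x^{ε/2}`"): for `m, r ≥ 1`, `q₁ ≠ 0`, `(m, q₁r) = 1`, `|γ_q| ≤ τ(q)^B`, `|a| < mn` on `n ∼ N`, the
Lemma-3 bound for the divisors `g ≤ G₀` of `q₁` and the uniform bound `T` for `τ(mn−a)^{B+1}`:
`innerP[(q₁,q₂)>Q₀](m,r,q₁,n₁) ≤ ∑_{g∣q₁, g>Q₀} { C₃(2mN/(mgr))(τ(mgr) log 2mN)^{B₃} (g ≤ G₀);
T(2N/(G₀R)+1) (g > G₀) }`. [cite: BombieriFriedlanderIwaniecActa1986, §6 (6.3) p. 220] -/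
theorem innerP_gcd_le {a : ℤ} {N Q R Q₀ B : ℝ} (hN : 0 ≤ N) (hR : 0 < R) (hB : 0 ≤ B)
    {γ : ℕ → ℝ} (hγ : ∀ q, |γ q| ≤ (σ 0 q : ℝ) ^ B) {m r q₁ n₁ : ℕ} (hm : 0 < m) (hr : 0 < r)
    (hRr : R ≤ r) (hq₁ : q₁ ≠ 0) (hmqr : m.Coprime (q₁ * r))
    (ha : ∀ n ∈ dyadic N, |a| < ((m * n : ℕ) : ℤ))
    {C₃ B₃ X₀ ε₃ G₀ T : ℝ} (hG₀ : 0 < G₀) (hT : 0 ≤ T)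
    (hL3 : ∀ X : ℝ, X₀ ≤ X → ∀ k : ℕ, 0 < k → (k : ℝ) ≤ X ^ (1 - ε₃) → ∀ l : ZMod k,
      ∑ v ∈ l3Set a X k l, l3Term a (B + 1) v ≤ C₃ * (X / k) * ((σ 0 k : ℝ) * Real.log X) ^ B₃)
    (hX₀ : X₀ ≤ 2 * m * N)
    (hlev : ∀ g ∈ q₁.divisors, (g : ℝ) ≤ G₀ → ((m * (g * r) : ℕ) : ℝ) ≤ (2 * m * N) ^ (1 - ε₃))
    (hTv : ∀ n ∈ dyadic N, (σ 0 (((m * n : ℕ) : ℤ) - a).toNat : ℝ) ^ (B + 1) ≤ T) :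
    innerP a N Q γ (fun q₁' q₂ _ _ => ¬((Nat.gcd q₁' q₂ : ℝ) ≤ Q₀)) m r q₁ n₁ ≤
      ∑ g ∈ q₁.divisors, if Q₀ < (g : ℝ) then
        (if (g : ℝ) ≤ G₀ then
          C₃ * (2 * m * N / ((m * (g * r) : ℕ) : ℝ)) *
            ((σ 0 (m * (g * r)) : ℝ) * Real.log (2 * m * N)) ^ B₃
        else T * (2 * N / (G₀ * R) + 1)) else 0 := by
  classical
  unfold innerP
  set v : ℕ → ℕ := fun n₂ => (((m * n₂ : ℕ) : ℤ) - a).toNat with hvdef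
  have hstep1 : ∀ n₂ ∈ dyadic N,
      ∑ q₂ ∈ dyadic Q, (if ¬((Nat.gcd q₁ q₂ : ℝ) ≤ Q₀) ∧
        ((m * n₂ : ℕ) : ZMod (q₂ * r)) = (a : ZMod (q₂ * r)) then |γ q₂| else 0) ≤
      ∑ g ∈ q₁.divisors, if Q₀ < (g : ℝ) ∧ g * r ∣ v n₂ then (σ 0 (v n₂) : ℝ) ^ (B + 1) else 0 :=
    fun n₂ hn₂ => sum_dyadic_cong_gcd_abs_le hB hγ hq₁ (lt_of_le_of_lt (le_abs_self a) (ha n₂ hn₂))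
  rw [Finset.sum_comm]
  refine (Finset.sum_le_sum hstep1).trans ?_
  rw [Finset.sum_comm]
  refine Finset.sum_le_sum fun g hg => ?_
  have hgq₁ : g ∣ q₁ := Nat.dvd_of_mem_divisors hg
  have hg0 : 0 < g := Nat.pos_of_mem_divisors hg
  by_cases hQ₀g : Q₀ < (g : ℝ)
  · rw [if_pos hQ₀g]
    have hD : 0 < g * r := Nat.mul_pos hg0 hr
    have hmD : m.Coprime (g * r) := Nat.Coprime.coprime_dvd_right (Nat.mul_dvd_mul_right hgq₁ r) hmqr
    obtain ⟨c, hsub⟩ := exists_class_of_dvd (N := N) hmD ha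
    have hSg : ∑ n₂ ∈ dyadic N, (if Q₀ < (g : ℝ) ∧ g * r ∣ v n₂ then (σ 0 (v n₂) : ℝ) ^ (B + 1) else 0) ≤
        ∑ n₂ ∈ (dyadic N).filter (fun n : ℕ => (n : ZMod (g * r)) = c),
          (σ 0 (((m * n₂ : ℕ) : ℤ) - a).toNat : ℝ) ^ (B + 1) := by
      calc ∑ n₂ ∈ dyadic N, (if Q₀ < (g : ℝ) ∧ g * r ∣ v n₂ then (σ 0 (v n₂) : ℝ) ^ (B + 1) else 0)
          = ∑ n₂ ∈ (dyadic N).filter (fun n₂ => g * r ∣ v n₂), (σ 0 (v n₂) : ℝ) ^ (B + 1) := by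
            rw [Finset.sum_filter]
            exact Finset.sum_congr rfl fun n₂ _ => by simp [hQ₀g]
        _ ≤ _ := Finset.sum_le_sum_of_subset_of_nonneg hsub fun n _ _ => by positivity
    refine hSg.trans ?_
    by_cases hgG : (g : ℝ) ≤ G₀
    · rw [if_pos hgG]
      haveI : NeZero (g * r) := ⟨hD.ne'⟩
      refine (sum_class_rpow_sigma_le_l3 (by linarith) hN hm hD c ha).trans ?_
      have hk : 0 < m * (g * r) := Nat.mul_pos hm hD
      exact hL3 (2 * m * N) hX₀ (m * (g * r)) hk (hlev g hg hgG) ((m * c.val : ℕ) : ZMod (m * (g * r)))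
    · rw [if_neg hgG]
      calc ∑ n₂ ∈ (dyadic N).filter (fun n : ℕ => (n : ZMod (g * r)) = c),
            (σ 0 (((m * n₂ : ℕ) : ℤ) - a).toNat : ℝ) ^ (B + 1)
          ≤ ∑ n₂ ∈ (dyadic N).filter (fun n : ℕ => (n : ZMod (g * r)) = c), T :=
            Finset.sum_le_sum fun n₂ hn₂ => hTv n₂ (Finset.mem_filter.1 hn₂).1
        _ = #((dyadic N).filter (fun n : ℕ => (n : ZMod (g * r)) = c)) * T := by
            rw [Finset.sum_const, nsmul_eq_mul]
        _ ≤ (2 * N / ((g * r : ℕ) : ℝ) + 1) * T :=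
            mul_le_mul_of_nonneg_right (card_dyadic_class_le hN hD c) hT
        _ ≤ (2 * N / (G₀ * R) + 1) * T := by
            refine mul_le_mul_of_nonneg_right ?_ hT
            have hg' : G₀ < g := not_le.1 hgG
            have : G₀ * R ≤ ((g * r : ℕ) : ℝ) := by
              push_cast
              exact mul_le_mul hg'.le hRr hR.le (by positivity)
            have hGR : 0 < G₀ * R := mul_pos hG₀ hR
            gcongr
        _ = T * (2 * N / (G₀ * R) + 1) := mul_comm _ _
  · rw [if_neg hQ₀g]
    refine le_of_eq (Finset.sum_eq_zero fun n₂ _ => ?_)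
    rw [if_neg (fun h => hQ₀g h.1)]


/-! ### Simplified inner bounds -/

/-- `τ(p) = 2` for a prime `p`. [folklore] -/
theorem sigma_zero_prime {p : ℕ} (hp : p.Prime) : σ 0 p = 2 := by
  rw [ArithmeticFunction.sigma_zero_apply, hp.divisors, Finset.card_pair hp.one_lt.ne]

/-- From `mn₁ ≡ a (k)` with `(k, a) = 1`: `(m, k) = (n₁, k) = 1`. [folklore] -/
theorem coprime_of_mul_congr {a : ℤ} {m n₁ k : ℕ} (hk : 0 < k) (hc₀ : IsCoprime (k : ℤ) a)
    (hc : ((m * n₁ : ℕ) : ZMod k) = (a : ZMod k)) : m.Coprime k ∧ n₁.Coprime k := by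
  haveI : NeZero k := ⟨hk.ne'⟩
  have hu : IsUnit ((a : ℤ) : ZMod k) := (ZMod.coe_int_isUnit_iff_isCoprime a k).2 hc₀
  rw [← hc, Nat.cast_mul] at hu
  exact ⟨(ZMod.isUnit_iff_coprime m k).1 (isUnit_of_mul_isUnit_left hu),
    (ZMod.isUnit_iff_coprime n₁ k).1 (isUnit_of_mul_isUnit_right hu)⟩

/-- **Simplified bound for the pairs with a common factor**: under the hypotheses of
`BFI.innerP_ncop_le`, with `C₃, B₃ ≥ 0`, `0 ≤ log(2mN) ≤ lg`, and all prime factors of `n₁` being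
`≥ z > 0` ((A₄)),
`innerP[(n₁,n₂)>1] ≤ ω(n₁) · (C₃ (2N/r)(2τ(r)·lg)^{B₃}/z · τ(m)^{B₃} + T(2N/(P₀R)+1))`.
[cite: BombieriFriedlanderIwaniecActa1986, §6 (6.4) p. 220] -/
theorem innerP_ncop_le' {a : ℤ} {N Q R B : ℝ} (hN : 0 ≤ N) (hR : 0 < R) (hB : 0 ≤ B) {γ : ℕ → ℝ}
    (hγ : ∀ q, |γ q| ≤ (σ 0 q : ℝ) ^ B) {m r q₁ n₁ : ℕ} (hm : 0 < m) (hr : 0 < r) (hRr : R ≤ r)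
    (hmr : m.Coprime r) (hn₁ : n₁ ≠ 0) (hn₁r : n₁.Coprime r)
    (ha : ∀ n ∈ dyadic N, |a| < ((m * n : ℕ) : ℤ))
    {C₃ B₃ X₀ ε₃ P₀ T lg z : ℝ} (hC₃ : 0 ≤ C₃) (hB₃ : 0 ≤ B₃) (hP₀ : 0 < P₀) (hT : 0 ≤ T)
    (hz : 0 < z) (hzp : ∀ p ∈ n₁.primeFactors, z ≤ (p : ℝ))
    (hlg0 : 0 ≤ Real.log (2 * m * N)) (hlg : Real.log (2 * m * N) ≤ lg)
    (hL3 : ∀ X : ℝ, X₀ ≤ X → ∀ k : ℕ, 0 < k → (k : ℝ) ≤ X ^ (1 - ε₃) → ∀ l : ZMod k,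
      ∑ v ∈ l3Set a X k l, l3Term a (B + 1) v ≤ C₃ * (X / k) * ((σ 0 k : ℝ) * Real.log X) ^ B₃)
    (hX₀ : X₀ ≤ 2 * m * N)
    (hlev : ∀ p ∈ n₁.primeFactors, (p : ℝ) ≤ P₀ → ((m * (p * r) : ℕ) : ℝ) ≤ (2 * m * N) ^ (1 - ε₃))
    (hTv : ∀ n ∈ dyadic N, (σ 0 (((m * n : ℕ) : ℤ) - a).toNat : ℝ) ^ (B + 1) ≤ T) :
    innerP a N Q γ (fun _ _ n₁' n₂ => ¬n₁'.Coprime n₂) m r q₁ n₁ ≤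
      (n₁.primeFactors.card : ℝ) *
        (C₃ * (2 * N / r) * (2 * (σ 0 r : ℝ) * lg) ^ B₃ / z * (σ 0 m : ℝ) ^ B₃ +
          T * (2 * N / (P₀ * R) + 1)) := by
  refine (innerP_ncop_le hN hR hB hγ hm hr hRr hmr hn₁ hn₁r ha hP₀ hT hL3 hX₀ hlev hTv).trans ?_
  have hlgnn : 0 ≤ lg := hlg0.trans hlg
  set A : ℝ := C₃ * (2 * N / r) * (2 * (σ 0 r : ℝ) * lg) ^ B₃ / z * (σ 0 m : ℝ) ^ B₃ with hA
  set Bc : ℝ := T * (2 * N / (P₀ * R) + 1) with hBc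
  have hA0 : 0 ≤ A := by positivity
  have hBc0 : 0 ≤ Bc := by positivity
  have hpt : ∀ p ∈ n₁.primeFactors,
      (if (p : ℝ) ≤ P₀ then C₃ * (2 * m * N / ((m * (p * r) : ℕ) : ℝ)) *
        ((σ 0 (m * (p * r)) : ℝ) * Real.log (2 * m * N)) ^ B₃ else T * (2 * N / (P₀ * R) + 1)) ≤
      A + Bc := by
    intro p hp
    have hpP := Nat.prime_of_mem_primeFactors hp
    have hp0 : (0 : ℝ) < p := by exact_mod_cast hpP.pos
    split_ifs with hle
    · -- the Lemma-3 term
      have e1 : 2 * m * N / ((m * (p * r) : ℕ) : ℝ) = 2 * N / (p * r) := by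
        have : (0 : ℝ) < m := by exact_mod_cast hm
        have : (0 : ℝ) < r := by exact_mod_cast hr
        push_cast
        field_simp
      have e2 : ((σ 0 (m * (p * r)) : ℝ) * Real.log (2 * m * N)) ^ B₃ ≤
          (2 * (σ 0 r : ℝ) * lg) ^ B₃ * (σ 0 m : ℝ) ^ B₃ := by
        rw [← Real.mul_rpow (by positivity) (by positivity)]
        refine Real.rpow_le_rpow (by positivity) ?_ hB₃
        have h1 : (σ 0 (m * (p * r)) : ℝ) ≤ (σ 0 m : ℝ) * (2 * σ 0 r) := by
          have := sigma_zero_mul_le m (p * r)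
          have h2 := sigma_zero_mul_le p r
          rw [sigma_zero_prime hpP] at h2
          calc (σ 0 (m * (p * r)) : ℝ) ≤ ((σ 0 m * σ 0 (p * r) : ℕ) : ℝ) := by exact_mod_cast this
            _ ≤ ((σ 0 m * (2 * σ 0 r) : ℕ) : ℝ) := by exact_mod_cast Nat.mul_le_mul_left _ h2
            _ = _ := by push_cast; ring
        calc (σ 0 (m * (p * r)) : ℝ) * Real.log (2 * m * N)
            ≤ ((σ 0 m : ℝ) * (2 * σ 0 r)) * lg := mul_le_mul h1 hlg hlg0 (by positivity)
          _ = 2 * (σ 0 r : ℝ) * lg * (σ 0 m : ℝ) := by ring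
      have e3 : 2 * N / (p * r) ≤ 2 * N / r / z := by
        rw [div_div, mul_comm (r : ℝ) z]
        have : (0 : ℝ) < r := by exact_mod_cast hr
        exact div_le_div_of_nonneg_left (by positivity) (by positivity)
          (mul_le_mul_of_nonneg_right (hzp p hp) this.le)
      calc C₃ * (2 * m * N / ((m * (p * r) : ℕ) : ℝ)) *
            ((σ 0 (m * (p * r)) : ℝ) * Real.log (2 * m * N)) ^ B₃
          = C₃ * (2 * N / (p * r)) * ((σ 0 (m * (p * r)) : ℝ) * Real.log (2 * m * N)) ^ B₃ := by
            rw [e1]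
        _ ≤ C₃ * (2 * N / r / z) * ((2 * (σ 0 r : ℝ) * lg) ^ B₃ * (σ 0 m : ℝ) ^ B₃) := by
            refine mul_le_mul (mul_le_mul_of_nonneg_left e3 hC₃) e2 (by positivity) (by positivity)
        _ = A := by rw [hA]; ring
        _ ≤ A + Bc := by linarith
    · linarith
  calc ∑ p ∈ n₁.primeFactors, (if (p : ℝ) ≤ P₀ then C₃ * (2 * m * N / ((m * (p * r) : ℕ) : ℝ)) *
          ((σ 0 (m * (p * r)) : ℝ) * Real.log (2 * m * N)) ^ B₃ else T * (2 * N / (P₀ * R) + 1))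
      ≤ ∑ p ∈ n₁.primeFactors, (A + Bc) := Finset.sum_le_sum hpt
    _ = _ := by rw [Finset.sum_const, nsmul_eq_mul]

/-- **Simplified bound for the moduli `(q₁,q₂) > Q₀`**: under the hypotheses of `BFI.innerP_gcd_le`,
with `C₃, B₃ ≥ 0`, `Q₀ > 0`, `0 ≤ log(2mN) ≤ lg`,
`innerP[(q₁,q₂)>Q₀] ≤ τ(q₁) · (C₃(2N/(Q₀r))(τ(q₁)τ(r)·lg)^{B₃} τ(m)^{B₃} + T(2N/(G₀R)+1))`.
[cite: BombieriFriedlanderIwaniecActa1986, §6 (6.3) p. 220] -/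
theorem innerP_gcd_le' {a : ℤ} {N Q R Q₀ B : ℝ} (hN : 0 ≤ N) (hR : 0 < R) (hQ₀ : 0 < Q₀) (hB : 0 ≤ B)
    {γ : ℕ → ℝ} (hγ : ∀ q, |γ q| ≤ (σ 0 q : ℝ) ^ B) {m r q₁ n₁ : ℕ} (hm : 0 < m) (hr : 0 < r)
    (hRr : R ≤ r) (hq₁ : q₁ ≠ 0) (hmqr : m.Coprime (q₁ * r))
    (ha : ∀ n ∈ dyadic N, |a| < ((m * n : ℕ) : ℤ))
    {C₃ B₃ X₀ ε₃ G₀ T lg : ℝ} (hC₃ : 0 ≤ C₃) (hB₃ : 0 ≤ B₃) (hG₀ : 0 < G₀) (hT : 0 ≤ T)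
    (hlg0 : 0 ≤ Real.log (2 * m * N)) (hlg : Real.log (2 * m * N) ≤ lg)
    (hL3 : ∀ X : ℝ, X₀ ≤ X → ∀ k : ℕ, 0 < k → (k : ℝ) ≤ X ^ (1 - ε₃) → ∀ l : ZMod k,
      ∑ v ∈ l3Set a X k l, l3Term a (B + 1) v ≤ C₃ * (X / k) * ((σ 0 k : ℝ) * Real.log X) ^ B₃)
    (hX₀ : X₀ ≤ 2 * m * N)
    (hlev : ∀ g ∈ q₁.divisors, (g : ℝ) ≤ G₀ → ((m * (g * r) : ℕ) : ℝ) ≤ (2 * m * N) ^ (1 - ε₃))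
    (hTv : ∀ n ∈ dyadic N, (σ 0 (((m * n : ℕ) : ℤ) - a).toNat : ℝ) ^ (B + 1) ≤ T) :
    innerP a N Q γ (fun q₁' q₂ _ _ => ¬((Nat.gcd q₁' q₂ : ℝ) ≤ Q₀)) m r q₁ n₁ ≤
      (σ 0 q₁ : ℝ) * (C₃ * (2 * N / (Q₀ * r)) * ((σ 0 q₁ : ℝ) * (σ 0 r : ℝ) * lg) ^ B₃ * (σ 0 m : ℝ) ^ B₃ +
        T * (2 * N / (G₀ * R) + 1)) := by
  refine (innerP_gcd_le hN hR hB hγ hm hr hRr hq₁ hmqr ha hG₀ hT hL3 hX₀ hlev hTv).trans ?_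
  have hlgnn : 0 ≤ lg := hlg0.trans hlg
  set A : ℝ := C₃ * (2 * N / (Q₀ * r)) * ((σ 0 q₁ : ℝ) * (σ 0 r : ℝ) * lg) ^ B₃ * (σ 0 m : ℝ) ^ B₃
    with hA
  set Bc : ℝ := T * (2 * N / (G₀ * R) + 1) with hBc
  have hA0 : 0 ≤ A := by positivity
  have hBc0 : 0 ≤ Bc := by positivity
  have hr0 : (0 : ℝ) < r := by exact_mod_cast hr
  have hm0 : (0 : ℝ) < m := by exact_mod_cast hm
  have hpt : ∀ g ∈ q₁.divisors, (if Q₀ < (g : ℝ) then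
      (if (g : ℝ) ≤ G₀ then C₃ * (2 * m * N / ((m * (g * r) : ℕ) : ℝ)) *
        ((σ 0 (m * (g * r)) : ℝ) * Real.log (2 * m * N)) ^ B₃ else T * (2 * N / (G₀ * R) + 1))
      else 0) ≤ A + Bc := by
    intro g hg
    have hgq : g ∣ q₁ := Nat.dvd_of_mem_divisors hg
    have hg0 : 0 < g := Nat.pos_of_mem_divisors hg
    have hg0' : (0 : ℝ) < g := by exact_mod_cast hg0
    split_ifs with h1 h2
    · have e1 : 2 * m * N / ((m * (g * r) : ℕ) : ℝ) = 2 * N / (g * r) := by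
        push_cast
        field_simp
      have e3 : 2 * N / (g * r) ≤ 2 * N / (Q₀ * r) :=
        div_le_div_of_nonneg_left (by positivity) (by positivity)
          (mul_le_mul_of_nonneg_right h1.le hr0.le)
      have e2 : ((σ 0 (m * (g * r)) : ℝ) * Real.log (2 * m * N)) ^ B₃ ≤
          ((σ 0 q₁ : ℝ) * (σ 0 r : ℝ) * lg) ^ B₃ * (σ 0 m : ℝ) ^ B₃ := by
        rw [← Real.mul_rpow (by positivity) (by positivity)]
        refine Real.rpow_le_rpow (by positivity) ?_ hB₃
        have h1' : (σ 0 (m * (g * r)) : ℝ) ≤ (σ 0 m : ℝ) * (σ 0 q₁ * σ 0 r) := by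
          have := sigma_zero_mul_le m (g * r)
          have h2 := sigma_zero_mul_le g r
          have h3 : σ 0 g ≤ σ 0 q₁ := sigma_zero_le_of_dvd hq₁ hgq
          calc (σ 0 (m * (g * r)) : ℝ) ≤ ((σ 0 m * σ 0 (g * r) : ℕ) : ℝ) := by exact_mod_cast this
            _ ≤ ((σ 0 m * (σ 0 q₁ * σ 0 r) : ℕ) : ℝ) := by
                exact_mod_cast Nat.mul_le_mul_left _ (h2.trans (Nat.mul_le_mul_right _ h3))
            _ = _ := by push_cast; ring
        calc (σ 0 (m * (g * r)) : ℝ) * Real.log (2 * m * N)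
            ≤ ((σ 0 m : ℝ) * (σ 0 q₁ * σ 0 r)) * lg := mul_le_mul h1' hlg hlg0 (by positivity)
          _ = (σ 0 q₁ : ℝ) * (σ 0 r : ℝ) * lg * (σ 0 m : ℝ) := by ring
      calc C₃ * (2 * m * N / ((m * (g * r) : ℕ) : ℝ)) *
            ((σ 0 (m * (g * r)) : ℝ) * Real.log (2 * m * N)) ^ B₃
          = C₃ * (2 * N / (g * r)) * ((σ 0 (m * (g * r)) : ℝ) * Real.log (2 * m * N)) ^ B₃ := by
            rw [e1]
        _ ≤ C₃ * (2 * N / (Q₀ * r)) * (((σ 0 q₁ : ℝ) * (σ 0 r : ℝ) * lg) ^ B₃ * (σ 0 m : ℝ) ^ B₃) :=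
            mul_le_mul (mul_le_mul_of_nonneg_left e3 hC₃) e2 (by positivity) (by positivity)
        _ = A := by rw [hA]; ring
        _ ≤ A + Bc := by linarith
    · linarith
    · linarith
  calc ∑ g ∈ q₁.divisors, (if Q₀ < (g : ℝ) then
        (if (g : ℝ) ≤ G₀ then C₃ * (2 * m * N / ((m * (g * r) : ℕ) : ℝ)) *
          ((σ 0 (m * (g * r)) : ℝ) * Real.log (2 * m * N)) ^ B₃ else T * (2 * N / (G₀ * R) + 1))
        else 0)
      ≤ ∑ g ∈ q₁.divisors, (A + Bc) := Finset.sum_le_sum hpt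
    _ = _ := by rw [Finset.sum_const, nsmul_eq_mul, ← ArithmeticFunction.sigma_zero_apply]


/-! ### The `m`-sums -/

/-- **The `m`-sum in the class `mn₁ ≡ a (k)`**: for `0 < Y ≤ M`, `M ≥ 1`, `|a| < M − Y`, `k ≥ 1`
with `(k, a) = 1`, weights `α, β' ≥ 0`, and a Lemma-3 bound `hL3'` (exponent `A'`, level
`k ≤ (2M+Y)^{1−ε₃'}`):
`∑_{m ∈ mRange, mn₁≡a (k)} f(m)(α τ(m)^{A'} + β') ≤ α C₄((2M+Y)/k)(τ(k) log(2M+Y))^{B₄} + β'((2M+Y)/k + 1)`.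
[cite: BombieriFriedlanderIwaniecActa1986, §6 (6.3)–(6.4) p. 220] -/
theorem sum_m_congr_bump_le {a : ℤ} {M Y : ℝ} (hY : 0 < Y) (hYM : Y ≤ M) (hM1 : 1 ≤ M)
    (haM : (|a| : ℝ) < M - Y) {k : ℕ} (hk : 0 < k) (hc₀ : IsCoprime (k : ℤ) a) (n₁ : ℕ)
    {α β' A' C₄ B₄ X₀' ε₃' : ℝ} (hα : 0 ≤ α) (hβ' : 0 ≤ β') (hA' : 0 ≤ A') (hC₄ : 0 ≤ C₄)
    (hL3' : ∀ X : ℝ, X₀' ≤ X → ∀ k' : ℕ, 0 < k' → (k' : ℝ) ≤ X ^ (1 - ε₃') → ∀ l : ZMod k',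
      ∑ v ∈ l3Set a X k' l, l3Term a A' v ≤ C₄ * (X / k') * ((σ 0 k' : ℝ) * Real.log X) ^ B₄)
    (hX₀' : X₀' ≤ 2 * M + Y) (hlev' : (k : ℝ) ≤ (2 * M + Y) ^ (1 - ε₃')) :
    ∑ m ∈ (mRange M Y).filter (fun m : ℕ => ((m * n₁ : ℕ) : ZMod k) = (a : ZMod k)),
        bump M Y m * (α * (σ 0 m : ℝ) ^ A' + β') ≤
      α * (C₄ * ((2 * M + Y) / k) * ((σ 0 k : ℝ) * Real.log (2 * M + Y)) ^ B₄) +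
        β' * ((2 * M + Y) / k + 1) := by
  classical
  haveI : NeZero k := ⟨hk.ne'⟩
  have hM : 0 ≤ M := by linarith
  have hlog : 0 ≤ Real.log (2 * M + Y) := Real.log_nonneg (by linarith)
  have hRHS : 0 ≤ α * (C₄ * ((2 * M + Y) / k) * ((σ 0 k : ℝ) * Real.log (2 * M + Y)) ^ B₄) +
      β' * ((2 * M + Y) / k + 1) := by positivity
  have hua : IsUnit ((a : ℤ) : ZMod k) := (ZMod.coe_int_isUnit_iff_isCoprime a k).2 hc₀
  by_cases hu : IsUnit (n₁ : ZMod k)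
  · -- the class `l = a n₁⁻¹`
    set l : ZMod k := (a : ZMod k) * ((hu.unit⁻¹ : (ZMod k)ˣ) : ZMod k) with hl
    have hiff : ∀ m : ℕ, ((m * n₁ : ℕ) : ZMod k) = (a : ZMod k) ↔ (m : ZMod k) = l := by
      intro m
      rw [Nat.cast_mul, hl]
      constructor
      · intro h
        rw [← h, mul_assoc, hu.mul_val_inv, mul_one]
      · intro h
        rw [h, mul_assoc, hu.val_inv_mul, mul_one]
    rw [Finset.filter_congr fun m _ => hiff m]
    have hsplit : ∑ m ∈ (mRange M Y).filter (fun m : ℕ => (m : ZMod k) = l),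
        bump M Y m * (α * (σ 0 m : ℝ) ^ A' + β') =
        ∑ m ∈ (mRange M Y).filter (fun m : ℕ => (m : ZMod k) = l), bump M Y m * (α * (σ 0 m : ℝ) ^ A') +
        ∑ m ∈ (mRange M Y).filter (fun m : ℕ => (m : ZMod k) = l), bump M Y m * β' := by
      rw [← Finset.sum_add_distrib]
      exact Finset.sum_congr rfl fun m _ => by ring
    rw [hsplit]
    refine add_le_add ?_ ?_
    · calc ∑ m ∈ (mRange M Y).filter (fun m : ℕ => (m : ZMod k) = l), bump M Y m * (α * (σ 0 m : ℝ) ^ A')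
          = α * ∑ m ∈ (mRange M Y).filter (fun m : ℕ => (m : ZMod k) = l),
              bump M Y m * (σ 0 m : ℝ) ^ A' := by
            rw [Finset.mul_sum]; exact Finset.sum_congr rfl fun m _ => by ring
        _ ≤ α * (C₄ * ((2 * M + Y) / k) * ((σ 0 k : ℝ) * Real.log (2 * M + Y)) ^ B₄) := by
            refine mul_le_mul_of_nonneg_left ?_ hα
            exact (sum_mRange_bump_rpow_sigma_le_l3 hA' hY hYM haM l).trans
              (hL3' (2 * M + Y) hX₀' k hk hlev' l)
    · calc ∑ m ∈ (mRange M Y).filter (fun m : ℕ => (m : ZMod k) = l), bump M Y m * β'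
          = β' * ∑ m ∈ (mRange M Y).filter (fun m : ℕ => (m : ZMod k) = l), bump M Y m := by
            rw [Finset.mul_sum]; exact Finset.sum_congr rfl fun m _ => by ring
        _ ≤ β' * ((2 * M + Y) / k + 1) :=
            mul_le_mul_of_nonneg_left (sum_mRange_bump_class_le hY hYM hk l) hβ'
  · -- no `m` at all
    rw [Finset.filter_false_of_mem, Finset.sum_empty]
    · exact hRHS
    · intro m _ h
      apply hu
      rw [← h, Nat.cast_mul] at hua
      exact isUnit_of_mul_isUnit_right hua


/-! ### The bound for `𝒮₁` off the main range -/

/-- Facts about a relevant `m`: `m ∈ mRange` with `f(m) ≠ 0` has `M − Y < m ≤ 2M + Y`, so `m ≥ 1`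
and `|a| < mn` for `n ≥ 1` when `|a| < M − Y`. [folklore] -/
theorem mRange_bump_facts {a : ℤ} {M Y : ℝ} (hY : 0 < Y) (hYM : Y ≤ M) (haM : (|a| : ℝ) < M - Y)
    {m : ℕ} (hm : m ∈ mRange M Y) (hb : bump M Y m ≠ 0) :
    M - Y < (m : ℝ) ∧ (m : ℝ) ≤ 2 * M + Y ∧ 0 < m ∧
      ∀ {N : ℝ}, 0 ≤ N → ∀ n ∈ dyadic N, |a| < ((m * n : ℕ) : ℤ) := by
  have hM : 0 ≤ M := hY.le.trans hYM
  have hmY : M - Y < (m : ℝ) := by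
    by_contra h
    exact hb (bump_eq_zero_of_le hY hM (not_lt.1 h))
  have hma : (|a| : ℝ) < m := haM.trans hmY
  have hm0 : 0 < m := by
    have : (0 : ℝ) < m := lt_of_le_of_lt (abs_nonneg _) hma
    exact_mod_cast this
  have hm2 : (m : ℝ) ≤ 2 * M + Y :=
    le_trans (by exact_mod_cast mem_mRange.1 hm) (Nat.floor_le (by linarith))
  refine ⟨hmY, hm2, hm0, fun hN n hn => ?_⟩
  have hn1 : 1 ≤ n := pos_of_mem_dyadic hN hn
  have h1 : |a| < (m : ℤ) := by
    have : ((|a| : ℤ) : ℝ) < (m : ℝ) := by push_cast; exact hma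
    exact_mod_cast this
  calc |a| < (m : ℤ) := h1
    _ = ((m * 1 : ℕ) : ℤ) := by push_cast; ring
    _ ≤ ((m * n : ℕ) : ℤ) := by exact_mod_cast Nat.mul_le_mul_left m hn1

set_option maxHeartbeats 800000 in -- one long assembly: two symmetric halves sharing `key`
/-- **BFI (6.3) + (6.4): `𝒮₁` off the main range** (p. 220), in structural form.  For the smoothed
sum with `S = mRange`, `w = f = bump M Y` (`0 < Y ≤ M`, `M ≥ 1`, `|a| < M − Y`), `N ≥ 1`, `Q, R,
Q₀ > 0`, `|γ_q| ≤ τ(q)^B`, `β` supported on integers all of whose prime factors exceed `z > 0`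
((A₄) = `BFI.IsSifted`), two instances `hL3`, `hL3'` of Lemma 3 (exponents `B+1` and `B₃`; from
`BombieriFriedlanderIwaniecLemma3_holds` in the assembly) with their thresholds and levels
(`hX₀, hX₀', hlev, hlev'`), a uniform divisor bound `T`, a bound `lg` for `log(2mN)` and `ω₀` for
`ω(n₁)`:
`|𝒮₁ⁿ| ≤ ∑_{r∼R} ∑_{q₁∼Q} |γ_{q₁}| ‖β‖² { ω₀ (C₃(2N/r)(2τ(r)lg)^{B₃}/z · L₄ + T(2N/(P₀R)+1)((2M+Y)/(q₁r)+1))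
  + τ(q₁) (C₃(2N/(Q₀r))(τ(q₁)τ(r)lg)^{B₃} · L₄ + T(2N/(P₀R)+1)((2M+Y)/(q₁r)+1)) }`,
`L₄ = C₄((2M+Y)/(q₁r))(τ(q₁r) log(2M+Y))^{B₄}` — i.e. (6.4) `‖β‖² x ℒ^{O(1)}/(zR)` + (6.3)
`‖β‖² x ℒ^{O(1)}/(Q₀R)` + the short-progression terms, after the divisor-sum averaging of the
assembly. [cite: BombieriFriedlanderIwaniecActa1986, §6 (6.3)–(6.4) p. 220] -/
theorem abs_dS1n_le {a : ℤ} {M Y N Q R Q₀ B z : ℝ} (hY : 0 < Y) (hYM : Y ≤ M) (hM1 : 1 ≤ M)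
    (haM : (|a| : ℝ) < M - Y) (hN : 1 ≤ N) (hQ : 0 < Q) (hR : 0 < R) (hQ₀ : 0 < Q₀) (hB : 0 ≤ B)
    {γ : ℕ → ℝ} (hγ : ∀ q, |γ q| ≤ (σ 0 q : ℝ) ^ B) (β : ℕ → ℝ) (hz : 0 < z)
    (hsift : IsSifted (dyadic N) z β)
    {C₃ B₃ X₀ ε₃ C₄ B₄ X₀' ε₃' P₀ T lg ω₀ : ℝ} (hC₃ : 0 ≤ C₃) (hB₃ : 0 ≤ B₃) (hC₄ : 0 ≤ C₄)
    (hP₀ : 0 < P₀) (hT : 0 ≤ T) (hω₀ : 0 ≤ ω₀)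
    (hL3 : ∀ X : ℝ, X₀ ≤ X → ∀ k : ℕ, 0 < k → (k : ℝ) ≤ X ^ (1 - ε₃) → ∀ l : ZMod k,
      ∑ v ∈ l3Set a X k l, l3Term a (B + 1) v ≤ C₃ * (X / k) * ((σ 0 k : ℝ) * Real.log X) ^ B₃)
    (hL3' : ∀ X : ℝ, X₀' ≤ X → ∀ k : ℕ, 0 < k → (k : ℝ) ≤ X ^ (1 - ε₃') → ∀ l : ZMod k,
      ∑ v ∈ l3Set a X k l, l3Term a B₃ v ≤ C₄ * (X / k) * ((σ 0 k : ℝ) * Real.log X) ^ B₄)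
    (hX₀ : X₀ ≤ 2 * (M - Y) * N) (hX₀' : X₀' ≤ 2 * M + Y)
    (hlev : ∀ m : ℕ, M - Y < (m : ℝ) → (m : ℝ) ≤ 2 * M + Y → ∀ t : ℕ, (t : ℝ) ≤ 2 * P₀ * R →
      ((m * t : ℕ) : ℝ) ≤ (2 * m * N) ^ (1 - ε₃))
    (hlev' : ∀ k : ℕ, (k : ℝ) ≤ 4 * Q * R → (k : ℝ) ≤ (2 * M + Y) ^ (1 - ε₃'))
    (hTv : ∀ m : ℕ, (m : ℝ) ≤ 2 * M + Y → ∀ n ∈ dyadic N,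
      (σ 0 (((m * n : ℕ) : ℤ) - a).toNat : ℝ) ^ (B + 1) ≤ T)
    (hlg : ∀ m : ℕ, M - Y < (m : ℝ) → (m : ℝ) ≤ 2 * M + Y →
      0 ≤ Real.log (2 * m * N) ∧ Real.log (2 * m * N) ≤ lg)
    (hω : ∀ n ∈ dyadic N, (n.primeFactors.card : ℝ) ≤ ω₀) :
    |dS1n a (mRange M Y) N Q R Q₀ (fun m => bump M Y m) β γ| ≤
      ∑ r ∈ dyadic R, ∑ q₁ ∈ dyadic Q, |γ q₁| * l2Sq N β *
        (ω₀ * (C₃ * (2 * N / r) * (2 * (σ 0 r : ℝ) * lg) ^ B₃ / z *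
            (C₄ * ((2 * M + Y) / ((q₁ * r : ℕ) : ℝ)) * ((σ 0 (q₁ * r) : ℝ) * Real.log (2 * M + Y)) ^ B₄) +
            T * (2 * N / (P₀ * R) + 1) * ((2 * M + Y) / ((q₁ * r : ℕ) : ℝ) + 1)) +
          (σ 0 q₁ : ℝ) * (C₃ * (2 * N / (Q₀ * r)) * ((σ 0 q₁ : ℝ) * (σ 0 r : ℝ) * lg) ^ B₃ *
            (C₄ * ((2 * M + Y) / ((q₁ * r : ℕ) : ℝ)) * ((σ 0 (q₁ * r) : ℝ) * Real.log (2 * M + Y)) ^ B₄) +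
            T * (2 * N / (P₀ * R) + 1) * ((2 * M + Y) / ((q₁ * r : ℕ) : ℝ) + 1))) := by
  classical
  have hM : 0 ≤ M := by linarith
  have hN0 : 0 ≤ N := by linarith
  have hw : ∀ m ∈ mRange M Y, 0 ≤ bump M Y m := fun m _ => (bump_mem_Icc hY hM _).1
  have hlog : 0 ≤ Real.log (2 * M + Y) := Real.log_nonneg (by linarith)
  -- abbreviations
  set Tc : ℝ := T * (2 * N / (P₀ * R) + 1) with hTc
  have hTc0 : 0 ≤ Tc := by positivity
  set L4 : ℕ → ℝ := fun k => C₄ * ((2 * M + Y) / (k : ℝ)) * ((σ 0 k : ℝ) * Real.log (2 * M + Y)) ^ B₄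
    with hL4
  have hL40 : ∀ k, 0 ≤ L4 k := fun k => by simp only [hL4]; positivity
  set αn : ℕ → ℝ := fun r => C₃ * (2 * N / r) * (2 * (σ 0 r : ℝ) * lg) ^ B₃ / z with hαn
  set αq : ℕ → ℕ → ℝ := fun r q₁ => C₃ * (2 * N / (Q₀ * r)) * ((σ 0 q₁ : ℝ) * (σ 0 r : ℝ) * lg) ^ B₃
    with hαq
  -- `lg ≥ 0` (there is at least one relevant `m`, e.g. `⌈M⌉`; but we only need it when used)
  -- common facts for a relevant `(r, q₁, n₁, m)`
  have key : ∀ r ∈ dyadic R, ∀ q₁ ∈ dyadic Q, ∀ n₁ ∈ dyadic N, β n₁ ≠ 0 → ∀ m ∈ mRange M Y,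
      bump M Y m ≠ 0 → IsCoprime ((q₁ * r : ℕ) : ℤ) a →
      ((m * n₁ : ℕ) : ZMod (q₁ * r)) = (a : ZMod (q₁ * r)) →
      0 < m ∧ 0 < r ∧ R ≤ (r : ℝ) ∧ q₁ ≠ 0 ∧ m.Coprime (q₁ * r) ∧ n₁.Coprime (q₁ * r) ∧ n₁ ≠ 0 ∧
        (∀ n ∈ dyadic N, |a| < ((m * n : ℕ) : ℤ)) ∧ (∀ p ∈ n₁.primeFactors, z ≤ (p : ℝ)) ∧
        0 ≤ Real.log (2 * m * N) ∧ Real.log (2 * m * N) ≤ lg ∧ X₀ ≤ 2 * m * N ∧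
        (∀ t : ℕ, (t : ℝ) ≤ 2 * P₀ * R → ((m * t : ℕ) : ℝ) ≤ (2 * m * N) ^ (1 - ε₃)) ∧
        (∀ n ∈ dyadic N, (σ 0 (((m * n : ℕ) : ℤ) - a).toNat : ℝ) ^ (B + 1) ≤ T) ∧
        M - Y < (m : ℝ) ∧ (m : ℝ) ≤ 2 * M + Y := by
    intro r hr q₁ hq₁ n₁ hn₁ hβ m hm hb hc₀ hc
    obtain ⟨hmY, hm2, hm0, ha⟩ := mRange_bump_facts hY hYM haM hm hb
    have hr' := (mem_dyadic hR.le).1 hr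
    have hr0 : 0 < r := pos_of_mem_dyadic hR.le hr
    have hq₁0 : 0 < q₁ := pos_of_mem_dyadic hQ.le hq₁
    have hn₁0 : 0 < n₁ := pos_of_mem_dyadic hN0 hn₁
    have hk : 0 < q₁ * r := Nat.mul_pos hq₁0 hr0
    obtain ⟨hmk, hnk⟩ := coprime_of_mul_congr hk hc₀ hc
    have hzp : ∀ p ∈ n₁.primeFactors, z ≤ (p : ℝ) := by
      intro p hp
      by_contra hlt
      have hpP := Nat.prime_of_mem_primeFactors hp
      exact hβ (hsift n₁ hn₁ ⟨p, hpP, Nat.dvd_of_mem_primeFactors hp, (not_le.1 hlt).le⟩)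
    obtain ⟨hlg0, hlg1⟩ := hlg m hmY hm2
    refine ⟨hm0, hr0, hr'.1.le, hq₁0.ne', hmk, hnk, hn₁0.ne', ha hN0, hzp, hlg0, hlg1, ?_,
      fun t ht => hlev m hmY hm2 t ht, fun n hn => hTv m hm2 n hn, hmY, hm2⟩
    calc X₀ ≤ 2 * (M - Y) * N := hX₀
      _ ≤ 2 * m * N := by nlinarith
  -- Part 1: the pairs with a common factor
  have hEn : restSum a (mRange M Y) N Q R (fun m => bump M Y m) β γ (fun _ _ n₁ n₂ => ¬n₁.Coprime n₂) ≤
      ∑ r ∈ dyadic R, ∑ q₁ ∈ dyadic Q, |γ q₁| * l2Sq N β *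
        (ω₀ * (αn r * L4 (q₁ * r) + Tc * ((2 * M + Y) / ((q₁ * r : ℕ) : ℝ) + 1))) := by
    refine (restSum_le_of_innerP_le a N Q R hw β γ _
      (G := fun m r q₁ n₁ => ω₀ * (αn r * (σ 0 m : ℝ) ^ B₃ + Tc)) ?_).trans ?_
    · intro r hr q₁ hq₁ n₁ hn₁ hβ m hm hb hc₀ hc
      obtain ⟨hm0, hr0, hRr, hq₁0, hmk, hnk, hn₁0, ha, hzp, hlg0, hlg1, hX₀m, hlevm, hTm, hmY, hm2⟩ :=
        key r hr q₁ hq₁ n₁ hn₁ hβ m hm hb hc₀ hc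
      have hmr : m.Coprime r := Nat.Coprime.coprime_dvd_right (dvd_mul_left r q₁) hmk
      have hn₁r : n₁.Coprime r := Nat.Coprime.coprime_dvd_right (dvd_mul_left r q₁) hnk
      have hr2 : (r : ℝ) ≤ 2 * R := ((mem_dyadic hR.le).1 hr).2
      have hlevp : ∀ p ∈ n₁.primeFactors, (p : ℝ) ≤ P₀ →
          ((m * (p * r) : ℕ) : ℝ) ≤ (2 * m * N) ^ (1 - ε₃) := by
        intro p hp hpP
        refine hlevm (p * r) ?_
        push_cast
        have : (0 : ℝ) ≤ p := by positivity
        nlinarith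
      refine (innerP_ncop_le' hN0 hR hB hγ hm0 hr0 hRr hmr hn₁0 hn₁r ha hC₃ hB₃ hP₀ hT hz hzp
        hlg0 hlg1 hL3 hX₀m hlevp hTm).trans ?_
      have hbr : 0 ≤ C₃ * (2 * N / r) * (2 * (σ 0 r : ℝ) * lg) ^ B₃ / z * (σ 0 m : ℝ) ^ B₃ +
          T * (2 * N / (P₀ * R) + 1) := by
        have : 0 ≤ lg := hlg0.trans hlg1
        positivity
      calc (n₁.primeFactors.card : ℝ) * (C₃ * (2 * N / r) * (2 * (σ 0 r : ℝ) * lg) ^ B₃ / z *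
            (σ 0 m : ℝ) ^ B₃ + T * (2 * N / (P₀ * R) + 1))
          ≤ ω₀ * (C₃ * (2 * N / r) * (2 * (σ 0 r : ℝ) * lg) ^ B₃ / z * (σ 0 m : ℝ) ^ B₃ +
            T * (2 * N / (P₀ * R) + 1)) := mul_le_mul_of_nonneg_right (hω n₁ hn₁) hbr
        _ = ω₀ * (αn r * (σ 0 m : ℝ) ^ B₃ + Tc) := by simp only [hαn, hTc]
    · refine Finset.sum_le_sum fun r hr => Finset.sum_le_sum fun q₁ hq₁ => ?_
      have hr0 : 0 < r := pos_of_mem_dyadic hR.le hr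
      have hq₁0 : 0 < q₁ := pos_of_mem_dyadic hQ.le hq₁
      have hk : 0 < q₁ * r := Nat.mul_pos hq₁0 hr0
      have hr' := (mem_dyadic hR.le).1 hr
      have hq₁' := (mem_dyadic hQ.le).1 hq₁
      have hklev : ((q₁ * r : ℕ) : ℝ) ≤ (2 * M + Y) ^ (1 - ε₃') := by
        refine hlev' (q₁ * r) ?_
        push_cast
        nlinarith [hq₁'.1, hq₁'.2, hr'.1, hr'.2]
      -- bound uniformly in `n₁`, then sum `β²`
      set X : ℝ := ω₀ * (αn r * L4 (q₁ * r) + Tc * ((2 * M + Y) / ((q₁ * r : ℕ) : ℝ) + 1)) with hX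
      have hterm : ∀ n₁ ∈ dyadic N, (if IsCoprime ((q₁ * r : ℕ) : ℤ) a then
          |γ q₁| * β n₁ ^ 2 * ∑ m ∈ (mRange M Y).filter
            (fun m : ℕ => ((m * n₁ : ℕ) : ZMod (q₁ * r)) = (a : ZMod (q₁ * r))),
            bump M Y m * (ω₀ * (αn r * (σ 0 m : ℝ) ^ B₃ + Tc)) else 0) ≤ |γ q₁| * β n₁ ^ 2 * X := by
        intro n₁ _
        by_cases hlgs : 0 ≤ lg
        · have hαn0 : 0 ≤ αn r := by simp only [hαn]; positivity
          have hX0 : 0 ≤ X := by simp only [hX]; positivity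
          split_ifs with hc₀
          · refine mul_le_mul_of_nonneg_left ?_ (by positivity)
            have hms := sum_m_congr_bump_le hY hYM hM1 haM hk hc₀ n₁ (mul_nonneg hω₀ hαn0)
              (mul_nonneg hω₀ hTc0) hB₃ hC₄ hL3' hX₀' hklev
            calc ∑ m ∈ (mRange M Y).filter
                  (fun m : ℕ => ((m * n₁ : ℕ) : ZMod (q₁ * r)) = (a : ZMod (q₁ * r))),
                  bump M Y m * (ω₀ * (αn r * (σ 0 m : ℝ) ^ B₃ + Tc))
                = ∑ m ∈ (mRange M Y).filter
                  (fun m : ℕ => ((m * n₁ : ℕ) : ZMod (q₁ * r)) = (a : ZMod (q₁ * r))),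
                  bump M Y m * ((ω₀ * αn r) * (σ 0 m : ℝ) ^ B₃ + ω₀ * Tc) :=
                  Finset.sum_congr rfl fun m _ => by ring
              _ ≤ (ω₀ * αn r) * (C₄ * ((2 * M + Y) / ((q₁ * r : ℕ) : ℝ)) *
                    ((σ 0 (q₁ * r) : ℝ) * Real.log (2 * M + Y)) ^ B₄) +
                  ω₀ * Tc * ((2 * M + Y) / ((q₁ * r : ℕ) : ℝ) + 1) := hms
              _ = X := by simp only [hX, hL4]; ring
          · positivity
        · -- `lg < 0`: then no relevant `m` exists with `β n₁ ≠ 0`… simpler: the `m`-sum is over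
          -- terms each `≤ 0`?? Not available; instead `lg < 0` contradicts `hlg` at `m = ⌈M⌉₊`.
          exfalso
          have hm : M - Y < ((⌈M⌉₊ : ℕ) : ℝ) ∧ ((⌈M⌉₊ : ℕ) : ℝ) ≤ 2 * M + Y := by
            constructor
            · exact lt_of_lt_of_le (by linarith) (Nat.le_ceil M)
            · have := Nat.ceil_lt_add_one hM; linarith
          obtain ⟨h0, h1⟩ := hlg ⌈M⌉₊ hm.1 hm.2
          exact hlgs (h0.trans h1)
      calc ∑ n₁ ∈ dyadic N, (if IsCoprime ((q₁ * r : ℕ) : ℤ) a then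
            |γ q₁| * β n₁ ^ 2 * ∑ m ∈ (mRange M Y).filter
              (fun m : ℕ => ((m * n₁ : ℕ) : ZMod (q₁ * r)) = (a : ZMod (q₁ * r))),
              bump M Y m * (ω₀ * (αn r * (σ 0 m : ℝ) ^ B₃ + Tc)) else 0)
          ≤ ∑ n₁ ∈ dyadic N, |γ q₁| * β n₁ ^ 2 * X := Finset.sum_le_sum hterm
        _ = |γ q₁| * l2Sq N β * X := by
            rw [l2Sq, Finset.mul_sum, Finset.sum_mul]
  -- Part 2: the moduli with `(q₁, q₂) > Q₀`
  have hEq : restSum a (mRange M Y) N Q R (fun m => bump M Y m) β γ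
      (fun q₁ q₂ _ _ => ¬((Nat.gcd q₁ q₂ : ℝ) ≤ Q₀)) ≤
      ∑ r ∈ dyadic R, ∑ q₁ ∈ dyadic Q, |γ q₁| * l2Sq N β *
        ((σ 0 q₁ : ℝ) * (αq r q₁ * L4 (q₁ * r) + Tc * ((2 * M + Y) / ((q₁ * r : ℕ) : ℝ) + 1))) := by
    refine (restSum_le_of_innerP_le a N Q R hw β γ _
      (G := fun m r q₁ n₁ => (σ 0 q₁ : ℝ) * (αq r q₁ * (σ 0 m : ℝ) ^ B₃ + Tc)) ?_).trans ?_
    · intro r hr q₁ hq₁ n₁ hn₁ hβ m hm hb hc₀ hc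
      obtain ⟨hm0, hr0, hRr, hq₁0, hmk, hnk, hn₁0, ha, hzp, hlg0, hlg1, hX₀m, hlevm, hTm, hmY, hm2⟩ :=
        key r hr q₁ hq₁ n₁ hn₁ hβ m hm hb hc₀ hc
      have hr2 : (r : ℝ) ≤ 2 * R := ((mem_dyadic hR.le).1 hr).2
      have hlevg : ∀ g ∈ q₁.divisors, (g : ℝ) ≤ P₀ →
          ((m * (g * r) : ℕ) : ℝ) ≤ (2 * m * N) ^ (1 - ε₃) := by
        intro g _ hgP
        refine hlevm (g * r) ?_
        push_cast
        have : (0 : ℝ) ≤ g := by positivity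
        nlinarith
      refine (innerP_gcd_le' hN0 hR hQ₀ hB hγ hm0 hr0 hRr hq₁0 hmk ha hC₃ hB₃ hP₀ hT hlg0 hlg1
        hL3 hX₀m hlevg hTm).trans ?_
      simp only [hαq, hTc]
      rfl
    · refine Finset.sum_le_sum fun r hr => Finset.sum_le_sum fun q₁ hq₁ => ?_
      have hr0 : 0 < r := pos_of_mem_dyadic hR.le hr
      have hq₁0 : 0 < q₁ := pos_of_mem_dyadic hQ.le hq₁
      have hk : 0 < q₁ * r := Nat.mul_pos hq₁0 hr0
      have hr' := (mem_dyadic hR.le).1 hr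
      have hq₁' := (mem_dyadic hQ.le).1 hq₁
      have hklev : ((q₁ * r : ℕ) : ℝ) ≤ (2 * M + Y) ^ (1 - ε₃') := by
        refine hlev' (q₁ * r) ?_
        push_cast
        nlinarith [hq₁'.1, hq₁'.2, hr'.1, hr'.2]
      set X : ℝ := (σ 0 q₁ : ℝ) * (αq r q₁ * L4 (q₁ * r) + Tc * ((2 * M + Y) / ((q₁ * r : ℕ) : ℝ) + 1))
        with hX
      have hterm : ∀ n₁ ∈ dyadic N, (if IsCoprime ((q₁ * r : ℕ) : ℤ) a then
          |γ q₁| * β n₁ ^ 2 * ∑ m ∈ (mRange M Y).filter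
            (fun m : ℕ => ((m * n₁ : ℕ) : ZMod (q₁ * r)) = (a : ZMod (q₁ * r))),
            bump M Y m * ((σ 0 q₁ : ℝ) * (αq r q₁ * (σ 0 m : ℝ) ^ B₃ + Tc)) else 0) ≤
          |γ q₁| * β n₁ ^ 2 * X := by
        intro n₁ _
        by_cases hlgs : 0 ≤ lg
        · have hαq0 : 0 ≤ αq r q₁ := by simp only [hαq]; positivity
          have hX0 : 0 ≤ X := by simp only [hX]; positivity
          split_ifs with hc₀
          · refine mul_le_mul_of_nonneg_left ?_ (by positivity)
            have hσ : 0 ≤ (σ 0 q₁ : ℝ) := by positivity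
            have hms := sum_m_congr_bump_le hY hYM hM1 haM hk hc₀ n₁ (mul_nonneg hσ hαq0)
              (mul_nonneg hσ hTc0) hB₃ hC₄ hL3' hX₀' hklev
            calc ∑ m ∈ (mRange M Y).filter
                  (fun m : ℕ => ((m * n₁ : ℕ) : ZMod (q₁ * r)) = (a : ZMod (q₁ * r))),
                  bump M Y m * ((σ 0 q₁ : ℝ) * (αq r q₁ * (σ 0 m : ℝ) ^ B₃ + Tc))
                = ∑ m ∈ (mRange M Y).filter
                  (fun m : ℕ => ((m * n₁ : ℕ) : ZMod (q₁ * r)) = (a : ZMod (q₁ * r))),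
                  bump M Y m * (((σ 0 q₁ : ℝ) * αq r q₁) * (σ 0 m : ℝ) ^ B₃ + (σ 0 q₁ : ℝ) * Tc) :=
                  Finset.sum_congr rfl fun m _ => by ring
              _ ≤ ((σ 0 q₁ : ℝ) * αq r q₁) * (C₄ * ((2 * M + Y) / ((q₁ * r : ℕ) : ℝ)) *
                    ((σ 0 (q₁ * r) : ℝ) * Real.log (2 * M + Y)) ^ B₄) +
                  (σ 0 q₁ : ℝ) * Tc * ((2 * M + Y) / ((q₁ * r : ℕ) : ℝ) + 1) := hms
              _ = X := by simp only [hX, hL4]; ring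
          · positivity
        · exfalso
          have hm : M - Y < ((⌈M⌉₊ : ℕ) : ℝ) ∧ ((⌈M⌉₊ : ℕ) : ℝ) ≤ 2 * M + Y := by
            constructor
            · exact lt_of_lt_of_le (by linarith) (Nat.le_ceil M)
            · have := Nat.ceil_lt_add_one hM; linarith
          obtain ⟨h0, h1⟩ := hlg ⌈M⌉₊ hm.1 hm.2
          exact hlgs (h0.trans h1)
      calc ∑ n₁ ∈ dyadic N, (if IsCoprime ((q₁ * r : ℕ) : ℤ) a then
            |γ q₁| * β n₁ ^ 2 * ∑ m ∈ (mRange M Y).filter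
              (fun m : ℕ => ((m * n₁ : ℕ) : ZMod (q₁ * r)) = (a : ZMod (q₁ * r))),
              bump M Y m * ((σ 0 q₁ : ℝ) * (αq r q₁ * (σ 0 m : ℝ) ^ B₃ + Tc)) else 0)
          ≤ ∑ n₁ ∈ dyadic N, |γ q₁| * β n₁ ^ 2 * X := Finset.sum_le_sum hterm
        _ = |γ q₁| * l2Sq N β * X := by
            rw [l2Sq, Finset.mul_sum, Finset.sum_mul]
  -- combine
  refine (abs_dS1n_le_restSum a N Q R Q₀ hw β γ).trans ?_
  refine (add_le_add hEn hEq).trans (le_of_eq ?_)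
  rw [← Finset.sum_add_distrib]
  refine Finset.sum_congr rfl fun r _ => ?_
  rw [← Finset.sum_add_distrib]
  refine Finset.sum_congr rfl fun q₁ _ => ?_
  simp only [hαn, hαq, hL4, hTc]
  ring

end BFI

end Literature.NumberTheory.Sieve
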